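import Literature.MathematicalPhysics.QuantumFieldTheory.Balaban1983to89.B15Prop1ClosedGuardUniformRadius
import Literature.MathematicalPhysics.QuantumFieldTheory.Balaban1983to89.B15Prop1SliceHessianOfChartFamily
import Literature.MathematicalPhysics.QuantumFieldTheory.Balaban1983to89.B16Ineq17NearFlatDatumFamily
import Literature.MathematicalPhysics.QuantumFieldTheory.Balaban1983to89.B16Ineq17NearFlatWilsonLettersLocal
import Literature.MathematicalPhysics.QuantumFieldTheory.Balaban1983to89.B15Prop1RealChartFamilySupport

/-!
# `Balaban1983to89.B15Prop1EndpointNearFlatLetters` — [Balaban1989LargeFieldI] = «[IV]», (1.74) p. 192, Prop. 1 (1.77)–(1.78) p. 194; [Balaban1989LargeFieldII] = «[LF-II]»,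
# p. 357, (1.7)–(1.9) p. 358, (1.12)–(1.13) p. 359; [Balaban1985Variational] = «[15]», Thm 1 (8) p. 279, (47) p. 285, (81) p. 290, Prop. 9 (190) p. 309:
# ★★★ THE ASSEMBLED ENDPOINT OF THE N12∕s1 LANE — PROPOSITION 1 [IV] AT PRINT'S (1.74) OBJECT WITH THE HESSIAN LETTER (L2) REPLACED BY THE NEAR-FLAT SKELETON'S
# LETTERS ALONG A C² FAMILY OF MINIMISERS, THE CONFIGURATION LETTER (J0′) IN COMPACT-UNIFORM FORM

Honest framing: statement-level skeleton of published theorems with citation tags; proofs where landed; nothing here is a claim about the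
Yang–Mills mass gap.  Cell `pub-ymgap`, HUMAN RULING D-0062 ∕ D-0149, seat `pub-ymgap-dag-n12-c` (g17; N12 = [B15], strategy s1, lane owner); count-neutral helper of
K1⁷; N12 NOT discharged; finite 𝕋⁴ at fixed ε; nothing continuum ∕ OS ∕ mass-gap ∕ Clay.

WHY.  The endpoint of record `B15Prop1ClosedGuardUniformRadius.…_ofMinimiserFamilyCompact_oneSided` (p601345 §4) reads Prop. 1 at print's (1.74) object from two analytic letters:
(J0′) `hMinC` (the compactness route's holomorphic minimiser charts, dag-n12-w1 lineage) and (L2⁻) `h17` (the one-sided (1.7): `γ₀·circ(X) − Cerr‖X‖² ≤ ⟪X, D(∇ sliceFn f Ṽ_k)(0) X⟫`).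
The D-0149 width wave typed the (L2) side in the currency of a near-flat constrained-critical background: dag-n12-w4's skeleton `hessian_wilsonAction4_criticalExpChartFamily_ge_flatMin_sub`
(p599997), its `haff` discharged at the chart of record `msChart` from the minimiser-family letter (K′) alone (`B16Ineq17NearFlatDatumFamily.haff_msChart_of_isMinimizer_family`, p608042),
and this lane's junction `B15Prop1SliceHessianOfChartFamily` (p604041: the value identity along the slice + the pairing identity ⇒ the `h17` SHAPE).  THIS MODULE composes them
ONCE: the endpoint with `h17` REPLACED, per instance `i` and per base field `V_k` in print's STRICT (1.74) guard, by the letter package (N) — SOME `SU(2)` configuration `U₀`, bond-wise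
`δ_i`-near-flat, and SOME real C² family `X_f` in the exponential chart at `U₀` with `X_f 0 = 0` whose members `expChart U₀ (X_f Y)` are (2.12) minimisers of the data along the slice
near `0` ((K′)); a second derivative `Ψ₂` and differentiability of the chart of record `Ψ := msChart … (M˙(Q_k^{s*}Ṽ_k)) U₀`, a multiplier `λ` with the Lagrange form
`D(A∘expChart U₀)(0) = λ∘DΨ(0)`, a seminorm `p` dominating `Σ_b‖·‖²_op`, a size `q`, a flat linearised constraint `L♭` with right inverse `R♭` (`p∘R♭ ≤ ρ_i·q`), and for every slice
vector `X` the displayed smallness letters (δ₂) `q(DΨ(0)X_f′X − L♭X_f′X) ≤ δ₂,i·p(X_f′X)`, (μ) `λ(Ψ₂(X_f′X,X_f′X)) ≤ μ_i·p(X_f′X)²`, (K) `p(X_f′X) ≤ K_i‖X‖` and the Federbush fibre letter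
`hm` with `γ₀·circ_i(X) ≤ m` (`circ_i` = the endpoint's curl sum).  Inside: (K′) ⇒ `hval` (p604041 §1) and ⇒ `haff` (p608042); then p604041 §4 gives the `h17` clause with
`Cerr_i = (32(d−1)δ_i + μ_i + 16(d−1)ρ_iδ₂,i(2+ρ_iδ₂,i))·K_i²`, and p601345 §4 concludes.  The remaining letters of (N) are linearised NODE-00 objects (dag-n10-w1's (δ₂) and right
inverse, dag-n12-w4's `hm_federbush_atBj_…` + twist (T) + `hΩk`, the multiplier bound (μ), the family's derivative bound (K) = `‖H₁‖`, the A₀-gauge near-flatness of `U₀`) — DISPLAYED.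

DECIDABILITY CONVENTION.  Unlike the instance-generic endpoints (binder `hdec` + `hcl`), this module is stated at the tree's ambient instance `B6Prop26ReachTransplant.instDecidableEqPBond`
(the one dag-n12-w4's p608042 is elaborated with), and feeds p601345 with `hcl := Subsingleton.elim _ _` — exactly what a Summits knit does.

CONTENTS (theorems only; no `def`, no `instance`, no `sorry`).
* §1 (private) `triple_of_contDiffAt_two` — `ContDiffAt ℝ 2 X_f 0` ⇒ the binder triple (`HasFDerivAt X_f (D X_f 0) 0`, `HasFDerivAt (D X_f) (D² X_f 0) 0`, differentiable near `0`) [folklore].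
* §2 ★★ `h17Clause_of_nearFlatLetters` — at one instance's objects and one base field: the package (N) ⇒ the `h17` clause for every slice vector `X`.
* §3 ★★★ `exists_domain_prop1Printed_lfVarOn_std_su2_box_intrinsic_analytic_atZSeqCoPRecord_ofThm1TorusClass_ofMinimiserFamilyCompact_ofNearFlatLetters_oneSided` — the assembled endpoint.
* §4 (v1.1) ★★ `h17Clause_of_nearFlatLetters_sub`, ★★★ `…_ofNearFlatLetters_sub_oneSided` — the TWIST editions (per-instance defect `τc i`: Federbush clause `γ₀·circ_i(X) − τc i·‖X‖² ≤ m`, `Cerr i` gains `+ τc i`).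
* §5 (v1.2) ★★ `h17Clause_of_nearFlatLetters_sub_loc`, ★★★ `…_ofNearFlatLetters_sub_loc_oneSided` — the TWIST + LOCALISED editions: `U₀`'s near-flatness asked only on the plaquettes with a bond
  starting in `Ω₁(Z)` (dag-n12-w5's LOCATED-hU); support of `X_f′X` from `B15Prop1RealChartFamilySupport` inside; dag-n12-w4's localised skeleton `B16Ineq17NearFlatWilsonLettersLocal`.
HONEST SCOPE: composition by name of landed theorems; every letter of (N), (J0′) `hMinC`, [15] Thm 1 `h15T`, `hfar`, (Gᵃ) `hZblk` stays DISPLAYED; nothing of Bałaban's is asserted.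
-/

noncomputable section

open Set Finset Metric Filter
open scoped BigOperators Matrix RealInnerProductSpace Real InnerProductSpace Topology

namespace Literature.MathematicalPhysics.QuantumFieldTheory.Balaban1983to89.B15Prop1EndpointNearFlatLetters


open B15DeterminingSets GaugeField B16Sect1Backgrounds B15Prop1Carrier B8Eq17ClassAkV1 BlockAveraging
open B15Prop1SliceTaylorCalculus B15Prop1IntrinsicAnalyticExt B15Prop1ParametricZeroBranch B15Prop1LocalLettersOfFun B15Prop1IntrinsicOfFun
open B15Prop1IntrinsicOfRecord B15Prop1GradientFromNearValue B15Prop1GradientFromNearValueAtCoPRecord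
open B15Prop1AtZSequenceRecord B15Prop1DatumSmall7AtZSequence B15Prop1Thm1GeneralFormAtZSequence B15Prop1Thm1GeneralFormShapes
open B15Prop1JointHolomorphyFromBackground B15Prop1OneSidedIneq17OfFun B15Prop1OneSidedIneq17Edition B15Prop1ValueOfAnyMinimiser
open B15Prop1JointHolomorphyFromMinimiserFamilyOneSided B15Prop1JointHolomorphyFromMinimiserFamily B15Prop1ClosedGuardUniformRadius
open B15Prop1SliceHessianOfChartFamily (eventually_sliceFn_fun177std_bgMSCoPOfRecord_eq_wilsonAction4 h17Shape_sliceFn_of_nearFlatCriticalExpChartFamily)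
open B16Ineq17NearFlatDatumFamily (haff_msChart_of_isMinimizer_family)
open B16Ineq19FlatSliceChart (exists_lieSU2Coord)
open B15Prop1AnalyticExtClause (cplxVec cplxSlice cplxSlice_apply norm_cplxSlice norm_cplxVec reSlice anExt anExt_antitone)
open B15Prop1ChartCalculusSU2 (E3)
open T4CubeChartGnomonic (SU2)
open B15Prop1ChartSU2 (su2Chart)
open B15Prop1SliceCoordinates (GaugeSlice ιA freeBonds norm_ιA_apply_le)
open T4AdjointCovarianceUnitary (lieSU)
open T4AxialGaugeSmallField (castSite boxPlaqs)
open T4AxialGaugeFixing (TreeOrder boxDepth)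
open B7Prop1Explicit (e e_apply)
open B6BondElimination (unitVec)
open B6TreeGaugePoincare (curl)
open B16Eq18Proof (box mem_box)
open B15Extension193 (extend)
open B15ShellGauge193 (shellGauge)
open B5Bounds167Lattice (formDk ofRealCfg)
open B14DomainGeom (IsUnionOfCubes)
open B15Eq112TorusCover (cover)
open B14.Eq213MaximalDomains (side)
open B14.Eq213DetSet B14.Eq216Concrete B15Sect1Instances B15Eq177GaugeInvariance B15Eq177ValueInvariance B15Eq177ValueInvarianceCoDiv B16Sect1Wilson
open B14.Eq22Determines (blockIter IsBlockUnion)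
open Literature.MathematicalPhysics.QuantumFieldTheory.BalabanImbrieJaffe1984to88.BIJ85Eq453GaugeField
open B11Prop6Scheme (Prop4Hyp)
open Node00 (expChart msChart constrCard)
open T4Continuum
open scoped Matrix.Norms.L2Operator


/-! ## §1  Bookkeeping: `C²` at a point gives the skeleton's binder triple -/

section Triple

/-- `ContDiffAt ℝ 2 X 0` ⇒ `X` has a derivative at `0`, `D X` has a derivative at `0`, and `X` is differentiable near `0` (private plumbing for the skeleton's binders). [folklore] -/
private theorem triple_of_contDiffAt_two {G E : Type*} [NormedAddCommGroup G] [NormedSpace ℝ G] [NormedAddCommGroup E] [NormedSpace ℝ E]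
    {X : G → E} (h : ContDiffAt ℝ 2 X 0) :
    HasFDerivAt X (fderiv ℝ X 0) 0 ∧ HasFDerivAt (fun g => fderiv ℝ X g) (fderiv ℝ (fun g => fderiv ℝ X g) 0) 0 ∧
      ∀ᶠ g in 𝓝 (0 : G), DifferentiableAt ℝ X g := by
  refine ⟨(h.differentiableAt (by norm_num)).hasFDerivAt, ?_, ?_⟩
  · have h1 : ContDiffAt ℝ 1 (fun g => fderiv ℝ X g) 0 := h.fderiv_right (m := 1) (by norm_num)
    exact (h1.differentiableAt (by norm_num)).hasFDerivAt
  · obtain ⟨f', u, hu, -, huf⟩ := contDiffAt_one_iff.1 (h.of_le (by norm_num))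
    filter_upwards [hu] with g hg using (huf g hg).differentiableAt

end Triple

/-! ## §2  One instance, one base field: the package (N) gives the `h17` clause -/

section Clause

variable {F : T4Family}

/-- ★★ **THE `h17` CLAUSE FROM THE NEAR-FLAT LETTER PACKAGE (N) AT ONE BASE FIELD.**  At the objects of one Prop-1 instance (background `bgMSCoPOfRecord F 2 ν Kt k Ω` at the class of
record, determining set `𝐁_k(Z) = Bj M₁ Z k`, slice `GaugeSlice S T E3`, extended base field `Ṽ`), the package (N) — `U₀` bond-wise `δ`-near-flat, `X_f` with `X_f 0 = 0`, `C²` at `0`,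
(2.12) minimisers `expChart U₀ (X_f Y)` of the data `M˙(Q_k^{s*}(exp(i·ιA Y)·Ṽ))` near `Y = 0`, and the skeleton's linearised letters at the chart of record
`Ψ := msChart F 2 Kt k (Bj M₁ Z k) (M˙(Q_k^{s*}Ṽ)) U₀` — gives, for EVERY slice vector `X`, `γ₀·circ(X) − (32(d−1)δ + μ + 16(d−1)ρδ₂(2+ρδ₂))·K_c²·‖X‖² ≤ ⟪X, D(∇ sliceFn S T f Ṽ)(0) X⟫`
for print's function `f = fun177std (bgMSCoPOfRecord F 2 ν Kt k Ω) M₁ Z k`: (K′) ⇒ `hval` (p604041 §1) and `haff` (p608042), then p604041 §4.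
[cite: Balaban1989LargeFieldII, p.357, (1.7)–(1.9) p.358, (1.12)–(1.13) p.359; Balaban1989LargeFieldI, (1.74) p.192, (1.77) and Prop. 1 p.194; Balaban1985Variational, (47) p.285, (81) p.290, Prop. 9 (190) p.309] -/
theorem h17Clause_of_nearFlatLetters (ν : Node00.Stage7Numerics) (Kt : ℕ) {k : ℕ} (hk : k ≤ (F.P Kt).m + (F.P Kt).K) (Ω : ℕ → Set (Site (F.P Kt) 0))
    (M₁ : ℕ) (Z : Set (Site (F.P Kt) 0)) (S : Set (Site (F.P Kt) k)) (T : Finset (PBond (F.P Kt) k)) (V : GaugeField (F.P Kt) k SU2)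
    (circ : GaugeSlice S T E3 → ℝ) {γ₀ δ μ ρ δ₂ Kc : ℝ} (hδ0 : 0 ≤ δ) (hμ0 : 0 ≤ μ) (hρ0 : 0 ≤ ρ) (hδ₂0 : 0 ≤ δ₂)
    (U₀ : GaugeField (F.P Kt) 0 SU2) (hU : ∀ b : PBond (F.P Kt) 0, ‖((U₀ b : SU2) : Matrix (Fin 2) (Fin 2) ℂ) - 1‖ ≤ δ)
    (Xf : GaugeSlice S T E3 → PBond (F.P Kt) 0 → lieSU (Fin 2)) (hX₀ : Xf 0 = 0) (hXc : ContDiffAt ℝ 2 Xf 0)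
    (hmin : ∀ᶠ Y in 𝓝 (0 : GaugeSlice S T E3),
      IsMinimizer (Node00.avOfRecord F 2 Kt) (Node00.regMSCoPOfRecord F 2 ν Kt k Ω) (Bj M₁ Z k)
        (avgFamily (Node00.avOfRecord F 2 Kt) (qsstarGIter0 k (expMul su2Chart (ιA S T Y) V))) (expChart U₀ (Xf Y)))
    {Ψ₂ : (PBond (F.P Kt) 0 → lieSU (Fin 2)) →L[ℝ] (PBond (F.P Kt) 0 → lieSU (Fin 2)) →L[ℝ] (Fin (constrCard (Bj M₁ Z k) k) → lieSU (Fin 2))}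
    (hΨ₂ : HasFDerivAt (fun Y => fderiv ℝ (msChart F 2 Kt k (Bj M₁ Z k) (avgFamily (Node00.avOfRecord F 2 Kt) (qsstarGIter0 k V)) U₀) Y) Ψ₂ 0)
    (hΨd : ∀ᶠ Y in 𝓝 (0 : PBond (F.P Kt) 0 → lieSU (Fin 2)), DifferentiableAt ℝ (msChart F 2 Kt k (Bj M₁ Z k) (avgFamily (Node00.avOfRecord F 2 Kt) (qsstarGIter0 k V)) U₀) Y)
    {lam : (Fin (constrCard (Bj M₁ Z k) k) → lieSU (Fin 2)) →L[ℝ] ℝ}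
    (hlam : fderiv ℝ (fun Y : PBond (F.P Kt) 0 → lieSU (Fin 2) => wilsonAction4 (expChart U₀ Y)) 0 =
      lam.comp (fderiv ℝ (msChart F 2 Kt k (Bj M₁ Z k) (avgFamily (Node00.avOfRecord F 2 Kt) (qsstarGIter0 k V)) U₀) 0))
    (p : Seminorm ℝ (PBond (F.P Kt) 0 → lieSU (Fin 2))) (hp : ∀ Y : PBond (F.P Kt) 0 → lieSU (Fin 2), ∑ b, ‖(Y b : Matrix (Fin 2) (Fin 2) ℂ)‖ ^ 2 ≤ p Y ^ 2)
    (q : (Fin (constrCard (Bj M₁ Z k) k) → lieSU (Fin 2)) → ℝ) (Lf : (PBond (F.P Kt) 0 → lieSU (Fin 2)) →L[ℝ] (Fin (constrCard (Bj M₁ Z k) k) → lieSU (Fin 2)))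
    {Rf : (Fin (constrCard (Bj M₁ Z k) k) → lieSU (Fin 2)) → PBond (F.P Kt) 0 → lieSU (Fin 2)} (hRf : ∀ v, Lf (Rf v) = v) (hρ : ∀ v, p (Rf v) ≤ ρ * q v)
    -- per slice vector: (δ₂), (μ), (K) and the Federbush fibre letter with `γ₀·circ ≤ m`
    (hX : ∀ X : GaugeSlice S T E3,
      q (fderiv ℝ (msChart F 2 Kt k (Bj M₁ Z k) (avgFamily (Node00.avOfRecord F 2 Kt) (qsstarGIter0 k V)) U₀) 0 (fderiv ℝ Xf 0 X) - Lf (fderiv ℝ Xf 0 X))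
          ≤ δ₂ * p (fderiv ℝ Xf 0 X) ∧
      lam (Ψ₂ (fderiv ℝ Xf 0 X) (fderiv ℝ Xf 0 X)) ≤ μ * p (fderiv ℝ Xf 0 X) ^ 2 ∧
      p (fderiv ℝ Xf 0 X) ≤ Kc * ‖X‖ ∧
      ∃ m : ℝ, (∀ w', Lf w' = fderiv ℝ (msChart F 2 Kt k (Bj M₁ Z k) (avgFamily (Node00.avOfRecord F 2 Kt) (qsstarGIter0 k V)) U₀) 0 (fderiv ℝ Xf 0 X) →
          m ≤ fderiv ℝ (fun Y => fderiv ℝ (fun Y : PBond (F.P Kt) 0 → lieSU (Fin 2) => wilsonAction4 (expChart (1 : GaugeField (F.P Kt) 0 SU2) Y)) Y) 0 w' w') ∧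
        γ₀ * circ X ≤ m)
    (X : GaugeSlice S T E3) :
    γ₀ * circ X - (32 * (((F.P Kt).d : ℝ) - 1) * δ + μ + 16 * (((F.P Kt).d : ℝ) - 1) * (ρ * δ₂) * (2 + ρ * δ₂)) * Kc ^ 2 * ‖X‖ ^ 2
      ≤ ⟪X, fderiv ℝ (rGrad S T (sliceFn S T (fun177std (Node00.bgMSCoPOfRecord F 2 ν Kt k Ω) M₁ Z k) V)) 0 X⟫_ℝ := by
  obtain ⟨hX1, hX2, hXd⟩ := triple_of_contDiffAt_two hXc
  obtain ⟨hδ₂, hμ, hK, m, hm, hcirc⟩ := hX X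
  obtain ⟨φ, hφ⟩ := exists_lieSU2Coord
  have haff := haff_msChart_of_isMinimizer_family S T hk hφ (Bj M₁ Z k) (Node00.regMSCoPOfRecord F 2 ν Kt k Ω) V U₀ hmin lam X X
  have hval := eventually_sliceFn_fun177std_bgMSCoPOfRecord_eq_wilsonAction4 ν Kt k Ω M₁ Z S T V hmin
  exact h17Shape_sliceFn_of_nearFlatCriticalExpChartFamily S T (fun177std (Node00.bgMSCoPOfRecord F 2 ν Kt k Ω) M₁ Z k) V U₀ hδ0 hU hX₀ hX1 hX2 hXd
    hΨ₂ hΨd hlam X haff p hp q Lf hρ0 hμ0 hδ₂0 hRf hρ hδ₂ hμ hm hval hK hcirc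

end Clause

/-! ## §3  The assembled endpoint -/

section Endpoint


/-- ★★★ **PROPOSITION 1 [IV] AT PRINT'S (1.74) OBJECT — ONE-SIDED (1.7) EDITION — FROM THE COMPACTNESS ROUTE'S (J0′) AND THE NEAR-FLAT LETTER PACKAGE (N).**
`B15Prop1ClosedGuardUniformRadius.…_ofMinimiserFamilyCompact_oneSided` (p601345 §4) with its Hessian letter `h17` REPLACED by: per-instance nonnegative constants `δc`, `μc`, `ρc`, `δ₂c`,
`Kc` with `Cerr i := (32(d−1)δc i + μc i + 16(d−1)ρc i·δ₂c i·(2 + ρc i·δ₂c i))·(Kc i)²` in the numerics letter `hsm`, and the package `hNF`: for every instance `i` and every base field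
`V_k` in the STRICT (1.74) guard, SOME `U₀` and SOME `X_f` as in `h17Clause_of_nearFlatLetters` (the knit chooses them — e.g. `U₀` in an A₀-gauge and `X_f` the real shadow of the (J0′)
chart, n12-w5's (K′) producer) with the letters there, `circ_i(X)` being the endpoint's curl sum over the window `box (n+3) (lo−2)`.  Everything else ((J0′) `hMinC`, `hγle`, `hfar`,
(Gᵃ) `hZblk`, `hM2`∕`hdiv`, constants, [15] Thm 1 `h15T`, `[Finite ι]`) VERBATIM; stated at the tree's ambient bond decidability (knit convention, `hcl := Subsingleton.elim`).
[cite: Balaban1989LargeFieldI, (1.74) p.192, Prop. 1 (1.77)–(1.78) p.194 (incl. the last clause), (1.79) p.195; Balaban1989LargeFieldII, p.357, (1.7)–(1.9) p.358, (1.12)–(1.13) p.359;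
Balaban1985Variational, (7) p.278, Thm 1 (8) p.279, (47) p.285, (81) p.290, Prop. 9 (190) p.309; Balaban1988Convergent, (2.12)–(2.14) pp.256–257] -/
theorem exists_domain_prop1Printed_lfVarOn_std_su2_box_intrinsic_analytic_atZSeqCoPRecord_ofThm1TorusClass_ofMinimiserFamilyCompact_ofNearFlatLetters_oneSided
    {F : T4Family}
    (ν : Node00.Stage7Numerics) (Kt : ℕ) (hd3 : 3 ≤ (F.P Kt).d) (h0 : 0 < (F.P Kt).d) {ι : Type} [Finite ι]
    (Z Λ : ι → Set (Site (F.P Kt) 0)) (k : ι → ℕ) (M : ι → ℝ) (hk0 : ∀ i, 0 < k i) (hk : ∀ i, k i ≤ (F.P Kt).m + (F.P Kt).K)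
    (eR : ι → ℝ) (heR : ∀ i, 0 < eR i)
    (T : ∀ i, Finset (PBond (F.P Kt) (k i)))
    (lo hi : ι → Fin (F.P Kt).d → ℤ) (n : ι → ℕ) (hn : ∀ i κ, hi i κ ≤ lo i κ + n i) (hN : ∀ i, n i + 2 < (F.P Kt).sitesPerDir (k i))
    (hbox : ∀ i, pts (k i) (Λ i) = (castSite '' Set.Icc (lo i) (hi i) : Set (Site (F.P Kt) (k i))))
    (hZ : ∀ i, (boxPlaqs (lo i - 1) (hi i + 1) : Set (Plaq (F.P Kt) (k i))) ⊆ plaqsInside (pts (k i) (Z i)))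
    (hTG0 : ∀ i, T i = (box (fun κ => (hi i κ - lo i κ + 1).toNat) (lo i)).image fun x =>
      (⟨castSite (x - unitVec ⟨0, h0⟩), ⟨0, h0⟩⟩ : PBond (F.P Kt) (k i)))
    (hN5 : ∀ i κ, ((hi i κ - lo i κ + 1).toNat : ℤ) + 5 < (F.P Kt).sitesPerDir (k i))
    (K : ι → ℕ) (hK1 : ∀ i, 1 ≤ K i) (hKn : ∀ i κ, (hi i κ - lo i κ + 1).toNat ≤ K i)
    (ext : ∀ i, GaugeField (F.P Kt) (k i) SU2 → GaugeField (F.P Kt) (k i) SU2)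
    (hext : ∀ i Vk, ext i Vk = extend (pts (k i) (Λ i)) (shellGauge Vk (lo i) (hi i)) Vk)
    (hlohi : ∀ i, lo i ≤ hi i)
    {γ bx : ℝ} (hγ : 0 < γ) (hbx : 0 ≤ bx)
    (hbxM : ∀ i, 12 * ((F.P Kt).d : ℝ) * ((n i : ℝ) + 2) ^ 2 ≤ bx * (M i) ^ 2)
    {𝓐₀ : ι → ℝ} (hM : ∀ i, 1 ≤ (M i))
    {γ₀ : ℝ} (hγ₀ : 0 ≤ γ₀)
    -- (J0′) IN THE COMPACTNESS ROUTE'S SHAPE: for every compact set of base fields inside the closed guard, ONE radius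
    (hMinC : ∀ i (K : Set (GaugeField (F.P Kt) (k i) SU2)), IsCompact K →
      (∀ Vk ∈ K, ∀ p ∈ plaqsInside (pts (k i) (Z i ∩ (Λ i)ᶜ)), dist1 (GaugeField.plaqHol Vk p) ≤ eR i) →
      ∃ R : ℝ, 0 < R ∧ ∀ Vk ∈ K,
      ∃ Ũ : VecField (F.P Kt) (k i) (EuclideanSpace ℂ (Fin 3)) × VecField (F.P Kt) (k i) (EuclideanSpace ℂ (Fin 3)) →
          PBond (F.P Kt) 0 → Matrix (Fin 2) (Fin 2) ℂ,
        (∀ b a c, DifferentiableOn ℂ (fun z => Ũ z b a c) (ball 0 R)) ∧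
        (∀ z ∈ ball (0 : VecField (F.P Kt) (k i) (EuclideanSpace ℂ (Fin 3)) × VecField (F.P Kt) (k i) (EuclideanSpace ℂ (Fin 3))) R,
          ∀ b a c, ‖Ũ z b a c‖ ≤ 𝓐₀ i) ∧
        ∀ p B' : VecField (F.P Kt) (k i) E3, ‖p‖ < R → ‖B'‖ < R → ∃ U' : GaugeField (F.P Kt) 0 SU2,
          (∀ b, Ũ (cplxVec p, cplxVec B') b = ((U' b : SU2) : Matrix (Fin 2) (Fin 2) ℂ)) ∧
            IsMinimizer (Node00.avOfRecord F 2 Kt) (Node00.regMSCoPOfRecord F 2 ν Kt (k i) (maxDomT ν.M₁ (Z i))) (Bj ν.M₁ (Z i) (k i))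
              (avgFamily (Node00.avOfRecord F 2 Kt) (qsstarGIter0 (k i) (expMul su2Chart B' (ext i (expMul su2Chart p Vk))))) U')
    -- (N) THE NEAR-FLAT LETTER PACKAGE per instance and per base field in the STRICT guard (replaces (L2) `h17`)
    {δc μc ρc δ₂c Kc : ι → ℝ} (hδc0 : ∀ i, 0 ≤ δc i) (hμc0 : ∀ i, 0 ≤ μc i) (hρc0 : ∀ i, 0 ≤ ρc i) (hδ₂c0 : ∀ i, 0 ≤ δ₂c i)
    (hNF : ∀ i (Vk : GaugeField (F.P Kt) (k i) SU2), PlaqSmallOn (plaqsInside (pts (k i) (Z i ∩ (Λ i)ᶜ))) (eR i) Vk →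
      ∃ (U₀ : GaugeField (F.P Kt) 0 SU2) (Xf : GaugeSlice (pts (k i) (Λ i)) (T i) E3 → PBond (F.P Kt) 0 → lieSU (Fin 2)),
        (∀ b : PBond (F.P Kt) 0, ‖((U₀ b : SU2) : Matrix (Fin 2) (Fin 2) ℂ) - 1‖ ≤ δc i) ∧ Xf 0 = 0 ∧ ContDiffAt ℝ 2 Xf 0 ∧
        (∀ᶠ Y in 𝓝 (0 : GaugeSlice (pts (k i) (Λ i)) (T i) E3),
          IsMinimizer (Node00.avOfRecord F 2 Kt) (Node00.regMSCoPOfRecord F 2 ν Kt (k i) (maxDomT ν.M₁ (Z i))) (Bj ν.M₁ (Z i) (k i))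
            (avgFamily (Node00.avOfRecord F 2 Kt) (qsstarGIter0 (k i) (expMul su2Chart (ιA (pts (k i) (Λ i)) (T i) Y) (ext i Vk)))) (expChart U₀ (Xf Y))) ∧
        ∃ (Ψ₂ : (PBond (F.P Kt) 0 → lieSU (Fin 2)) →L[ℝ] (PBond (F.P Kt) 0 → lieSU (Fin 2)) →L[ℝ] (Fin (constrCard (Bj ν.M₁ (Z i) (k i)) (k i)) → lieSU (Fin 2)))
          (lam : (Fin (constrCard (Bj ν.M₁ (Z i) (k i)) (k i)) → lieSU (Fin 2)) →L[ℝ] ℝ)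
          (p : Seminorm ℝ (PBond (F.P Kt) 0 → lieSU (Fin 2))) (q : (Fin (constrCard (Bj ν.M₁ (Z i) (k i)) (k i)) → lieSU (Fin 2)) → ℝ)
          (Lf : (PBond (F.P Kt) 0 → lieSU (Fin 2)) →L[ℝ] (Fin (constrCard (Bj ν.M₁ (Z i) (k i)) (k i)) → lieSU (Fin 2)))
          (Rf : (Fin (constrCard (Bj ν.M₁ (Z i) (k i)) (k i)) → lieSU (Fin 2)) → PBond (F.P Kt) 0 → lieSU (Fin 2)),
          HasFDerivAt (fun Y => fderiv ℝ (msChart F 2 Kt (k i) (Bj ν.M₁ (Z i) (k i)) (avgFamily (Node00.avOfRecord F 2 Kt) (qsstarGIter0 (k i) (ext i Vk))) U₀) Y) Ψ₂ 0 ∧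
          (∀ᶠ Y in 𝓝 (0 : PBond (F.P Kt) 0 → lieSU (Fin 2)),
            DifferentiableAt ℝ (msChart F 2 Kt (k i) (Bj ν.M₁ (Z i) (k i)) (avgFamily (Node00.avOfRecord F 2 Kt) (qsstarGIter0 (k i) (ext i Vk))) U₀) Y) ∧
          fderiv ℝ (fun Y : PBond (F.P Kt) 0 → lieSU (Fin 2) => wilsonAction4 (expChart U₀ Y)) 0 =
            lam.comp (fderiv ℝ (msChart F 2 Kt (k i) (Bj ν.M₁ (Z i) (k i)) (avgFamily (Node00.avOfRecord F 2 Kt) (qsstarGIter0 (k i) (ext i Vk))) U₀) 0) ∧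
          (∀ Y : PBond (F.P Kt) 0 → lieSU (Fin 2), ∑ b, ‖(Y b : Matrix (Fin 2) (Fin 2) ℂ)‖ ^ 2 ≤ p Y ^ 2) ∧
          (∀ v, Lf (Rf v) = v) ∧ (∀ v, p (Rf v) ≤ ρc i * q v) ∧
          ∀ X : GaugeSlice (pts (k i) (Λ i)) (T i) E3,
            q (fderiv ℝ (msChart F 2 Kt (k i) (Bj ν.M₁ (Z i) (k i)) (avgFamily (Node00.avOfRecord F 2 Kt) (qsstarGIter0 (k i) (ext i Vk))) U₀) 0 (fderiv ℝ Xf 0 X)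
                - Lf (fderiv ℝ Xf 0 X)) ≤ δ₂c i * p (fderiv ℝ Xf 0 X) ∧
            lam (Ψ₂ (fderiv ℝ Xf 0 X) (fderiv ℝ Xf 0 X)) ≤ μc i * p (fderiv ℝ Xf 0 X) ^ 2 ∧
            p (fderiv ℝ Xf 0 X) ≤ Kc i * ‖X‖ ∧
            ∃ m : ℝ, (∀ w', Lf w' = fderiv ℝ (msChart F 2 Kt (k i) (Bj ν.M₁ (Z i) (k i)) (avgFamily (Node00.avOfRecord F 2 Kt) (qsstarGIter0 (k i) (ext i Vk))) U₀) 0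
                  (fderiv ℝ Xf 0 X) →
                m ≤ fderiv ℝ (fun Y => fderiv ℝ (fun Y : PBond (F.P Kt) 0 → lieSU (Fin 2) => wilsonAction4 (expChart (1 : GaugeField (F.P Kt) 0 SU2) Y)) Y) 0 w' w') ∧
              γ₀ * (∑ z ∈ box (fun κ => (hi i κ - lo i κ + 1).toNat + 3) (fun κ => lo i κ - 2), ∑ μ : Fin (F.P Kt).d, ∑ a : Fin 3,
                  curl (fun b => ιA (pts (k i) (Λ i)) (T i) X (⟨castSite b.1, b.2⟩ : PBond (F.P Kt) (k i)) a) z ⟨0, h0⟩ μ ^ 2) ≤ m)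
    -- numerics: the assembled `Cerr i` is small, and the positivity constant fits
    (hsm : ∀ i, (32 * (((F.P Kt).d : ℝ) - 1) * δc i + μc i + 16 * (((F.P Kt).d : ℝ) - 1) * (ρc i * δ₂c i) * (2 + ρc i * δ₂c i)) * Kc i ^ 2
      ≤ γ₀ / (2 * (3 * (K i : ℝ) ^ 2 + 2 * (K i : ℝ) ^ 4)))
    (hγle : ∀ i, γ / (M i) ^ 5 ≤ γ₀ / (2 * (3 * (K i : ℝ) ^ 2 + 2 * (K i : ℝ) ^ 4)))
    (hfar : ∀ i (b : PBond (F.P Kt) 0), b.src ∉ maxDomT ν.M₁ (Z i) 1 →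
      (⟨blockIter (k i) b.src, b.dir⟩ : PBond (F.P Kt) (k i)) ∉ bondsOf (pts (k i) (Λ i)))
    (hZblk : ∀ i, IsBlockUnion (k i) (Z i))
    (hM2 : 2 ≤ ν.M₁) (hdiv : ∀ i, side (F.P Kt).L ν.M₁ (k i) ∣ (F.P Kt).sitesPerDir 0)
    {cE B₃ a₀ a₁' cA : ℝ} (hcE0 : 0 ≤ cE) (hcE : ∀ i, 12 * ((F.P Kt).d : ℝ) * ((n i : ℝ) + 2) ^ 2 ≤ cE) (hB₃ : 0 ≤ B₃)
    (heRa : ∀ i, (cE + 1) * eR i ≤ a₁' ∧ B₃ * ((cE + 1) * eR i) ≤ ν.εreg) (ha₀ : ν.εreg ≤ a₀)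
    (hcA : 1 / 2 * (B₃ * (cE + 1) * (F.P Kt).eta 1 ^ 2) ^ 2 * (Fintype.card (Plaq (F.P Kt) 0) : ℝ) ≤ cA)
    (h15T : ∀ (k' : ℕ), k' ≤ (F.P Kt).m + (F.P Kt).K → side (F.P Kt).L ν.M₁ k' ∣ (F.P Kt).sitesPerDir 0 →
      ∀ (s : B14.Eq218Concrete.Seq (fun n : ℕ => Node00.unionsOfCubes (F.P Kt) (side (F.P Kt).L ν.M₁ n)) k'),
      Node00.Sect2.SeqSeparated ν.M₁ s → 0 < ν.M₁ →
      ∀ (ε₀ : ℝ) (δ : ℕ → ℝ), (∀ j, j ≤ k' → 0 < δ j ∧ δ j ≤ a₁' ∧ B₃ * δ j ≤ ε₀) → (∀ j, j < k' → δ j ≤ 2 * δ (j + 1)) →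
      (∀ j, j < k' → δ (j + 1) ≤ 2 * δ j) → ε₀ ≤ a₀ →
      ∀ W : MSField (F.P Kt) SU2,
        Node00.Sect2.DataSmall7PTop (Node00.avOfRecord F 2 Kt) s.Ω (Node00.suppDomOfRecord F ν Kt s.Ω) k' δ W →
        ∀ U₀ : GaugeField (F.P Kt) 0 SU2, IsMinimizer (Node00.avOfRecord F 2 Kt)
            {U | (∀ j, j ≤ k' → PlaqSmallOn (Node00.Sect2.omegaPlaqsTop s.Ω (Node00.suppDomOfRecord F ν Kt s.Ω) j)
                (ε₀ * (F.P Kt).eta j ^ 2) U) ∧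
              Node00.Sect2.CoDivClassOnTop s.Ω (Node00.suppDomOfRecord F ν Kt s.Ω) k' ε₀ U}
            (genSet s.Ω k') W U₀ →
          (∀ j, j ≤ k' → PlaqSmallOn (Node00.Sect2.omegaPlaqsTop s.Ω (Node00.suppDomOfRecord F ν Kt s.Ω) j)
              (B₃ * δ j * (F.P Kt).eta j ^ 2) U₀) ∧
            ∀ j, j ≤ k' → Node00.Sect2.CoDivSmallOn (Node00.Sect2.omegaBondsTop s.Ω (Node00.suppDomOfRecord F ν Kt s.Ω) j)
              (B₃ * δ j * (F.P Kt).eta j ^ 3) U₀)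
    : ∃ R : ι → ℝ, (∀ i, 0 < R i) ∧ ∃ a₁ : ι → ℝ, (∀ i, 0 < a₁ i) ∧
      B15.Prop1Printed (lfVarOn su2Chart fun i =>
        InstOn.std (Node00.bgMSCoPOfRecord F 2 ν Kt (k i) (maxDomT ν.M₁ (Z i))) ν.M₁ (Z i) (Λ i) (k i) (M i) (a₁ i)
          (anExt (pts (k i) (Λ i)) (T i)
            (fun177std (Node00.bgMSCoPOfRecord F 2 ν Kt (k i) (maxDomT ν.M₁ (Z i))) ν.M₁ (Z i) (k i)) (ext i)
            (min (1 / 2) (min (R i / 8) (γ / (M i) ^ 5 * (R i / 2) ^ 2 /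
              (48 * (4 * ((Fintype.card (Plaq (F.P Kt) 0) : ℝ) * (1 + 8 * 𝓐₀ i ^ 4)) / R i + 1))))))) :=
  exists_domain_prop1Printed_lfVarOn_std_su2_box_intrinsic_analytic_atZSeqCoPRecord_ofThm1TorusClass_ofMinimiserFamilyCompact_oneSided ν Kt hd3 h0
    (hdec := inferInstance) (Subsingleton.elim _ _)
    Z Λ k M hk0 hk eR heR T lo hi n hn hN hbox hZ hTG0 hN5 K hK1 hKn ext hext hlohi hγ hbx hbxM hM hγ₀ hMinC
    (Cerr := fun i => (32 * (((F.P Kt).d : ℝ) - 1) * δc i + μc i + 16 * (((F.P Kt).d : ℝ) - 1) * (ρc i * δ₂c i) * (2 + ρc i * δ₂c i)) * Kc i ^ 2)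
    (fun i Vk hV X => by
      obtain ⟨U₀, Xf, hU, hX₀, hXc, hmin, Ψ₂, lam, p, q, Lf, Rf, hΨ₂, hΨd, hlam, hp, hRf, hρ, hX⟩ := hNF i Vk hV
      exact h17Clause_of_nearFlatLetters ν Kt (hk i) (maxDomT ν.M₁ (Z i)) ν.M₁ (Z i) (pts (k i) (Λ i)) (T i) (ext i Vk)
        (fun X => ∑ z ∈ box (fun κ => (hi i κ - lo i κ + 1).toNat + 3) (fun κ => lo i κ - 2), ∑ μ : Fin (F.P Kt).d, ∑ a : Fin 3,
          curl (fun b => ιA (pts (k i) (Λ i)) (T i) X (⟨castSite b.1, b.2⟩ : PBond (F.P Kt) (k i)) a) z ⟨0, h0⟩ μ ^ 2)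
        (hδc0 i) (hμc0 i) (hρc0 i) (hδ₂c0 i) U₀ hU Xf hX₀ hXc hmin hΨ₂ hΨd hlam p hp q Lf hRf hρ hX X)
    hsm hγle hfar hZblk hM2 hdiv hcE0 hcE hB₃ heRa ha₀ hcA h15T

end Endpoint

/-! ## §4  (v1.1) The twist editions: the Federbush clause with the quadratic defect `τc i·‖X‖²` -/

section Twist

variable {F : T4Family}

/-- ★★ **THE `h17` CLAUSE FROM THE NEAR-FLAT LETTER PACKAGE (N) AT ONE BASE FIELD — TWIST EDITION**: as `h17Clause_of_nearFlatLetters`, with the Federbush fibre letter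
carrying the quadratic defect the Ad-twisted producers deliver, `γ₀·circ(X) − τ·‖X‖² ≤ m` (dag-n12-w4's located (R2) ∕ twist letter (T)); `Cerr` gains `+ τ`
(`B15Prop1SliceHessianOfChartFamily.h17Shape_sliceFn_of_nearFlatCriticalExpChartFamily_sub`).
[cite: Balaban1989LargeFieldII, p.357, (1.7)–(1.9) p.358, (1.12)–(1.13) p.359, (1.19) p.360; Balaban1989LargeFieldI, (1.74) p.192, (1.77) and Prop. 1 p.194; Balaban1985Variational, (47) p.285, (81) p.290, Prop. 9 (190) p.309] -/
theorem h17Clause_of_nearFlatLetters_sub (ν : Node00.Stage7Numerics) (Kt : ℕ) {k : ℕ} (hk : k ≤ (F.P Kt).m + (F.P Kt).K) (Ω : ℕ → Set (Site (F.P Kt) 0))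
    (M₁ : ℕ) (Z : Set (Site (F.P Kt) 0)) (S : Set (Site (F.P Kt) k)) (T : Finset (PBond (F.P Kt) k)) (V : GaugeField (F.P Kt) k SU2)
    (circ : GaugeSlice S T E3 → ℝ) {γ₀ δ μ ρ δ₂ Kc τ : ℝ} (hδ0 : 0 ≤ δ) (hμ0 : 0 ≤ μ) (hρ0 : 0 ≤ ρ) (hδ₂0 : 0 ≤ δ₂)
    (U₀ : GaugeField (F.P Kt) 0 SU2) (hU : ∀ b : PBond (F.P Kt) 0, ‖((U₀ b : SU2) : Matrix (Fin 2) (Fin 2) ℂ) - 1‖ ≤ δ)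
    (Xf : GaugeSlice S T E3 → PBond (F.P Kt) 0 → lieSU (Fin 2)) (hX₀ : Xf 0 = 0) (hXc : ContDiffAt ℝ 2 Xf 0)
    (hmin : ∀ᶠ Y in 𝓝 (0 : GaugeSlice S T E3),
      IsMinimizer (Node00.avOfRecord F 2 Kt) (Node00.regMSCoPOfRecord F 2 ν Kt k Ω) (Bj M₁ Z k)
        (avgFamily (Node00.avOfRecord F 2 Kt) (qsstarGIter0 k (expMul su2Chart (ιA S T Y) V))) (expChart U₀ (Xf Y)))
    {Ψ₂ : (PBond (F.P Kt) 0 → lieSU (Fin 2)) →L[ℝ] (PBond (F.P Kt) 0 → lieSU (Fin 2)) →L[ℝ] (Fin (constrCard (Bj M₁ Z k) k) → lieSU (Fin 2))}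
    (hΨ₂ : HasFDerivAt (fun Y => fderiv ℝ (msChart F 2 Kt k (Bj M₁ Z k) (avgFamily (Node00.avOfRecord F 2 Kt) (qsstarGIter0 k V)) U₀) Y) Ψ₂ 0)
    (hΨd : ∀ᶠ Y in 𝓝 (0 : PBond (F.P Kt) 0 → lieSU (Fin 2)), DifferentiableAt ℝ (msChart F 2 Kt k (Bj M₁ Z k) (avgFamily (Node00.avOfRecord F 2 Kt) (qsstarGIter0 k V)) U₀) Y)
    {lam : (Fin (constrCard (Bj M₁ Z k) k) → lieSU (Fin 2)) →L[ℝ] ℝ}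
    (hlam : fderiv ℝ (fun Y : PBond (F.P Kt) 0 → lieSU (Fin 2) => wilsonAction4 (expChart U₀ Y)) 0 =
      lam.comp (fderiv ℝ (msChart F 2 Kt k (Bj M₁ Z k) (avgFamily (Node00.avOfRecord F 2 Kt) (qsstarGIter0 k V)) U₀) 0))
    (p : Seminorm ℝ (PBond (F.P Kt) 0 → lieSU (Fin 2))) (hp : ∀ Y : PBond (F.P Kt) 0 → lieSU (Fin 2), ∑ b, ‖(Y b : Matrix (Fin 2) (Fin 2) ℂ)‖ ^ 2 ≤ p Y ^ 2)
    (q : (Fin (constrCard (Bj M₁ Z k) k) → lieSU (Fin 2)) → ℝ) (Lf : (PBond (F.P Kt) 0 → lieSU (Fin 2)) →L[ℝ] (Fin (constrCard (Bj M₁ Z k) k) → lieSU (Fin 2)))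
    {Rf : (Fin (constrCard (Bj M₁ Z k) k) → lieSU (Fin 2)) → PBond (F.P Kt) 0 → lieSU (Fin 2)} (hRf : ∀ v, Lf (Rf v) = v) (hρ : ∀ v, p (Rf v) ≤ ρ * q v)
    -- per slice vector: (δ₂), (μ), (K) and the Federbush fibre letter with `γ₀·circ ≤ m`
    (hX : ∀ X : GaugeSlice S T E3,
      q (fderiv ℝ (msChart F 2 Kt k (Bj M₁ Z k) (avgFamily (Node00.avOfRecord F 2 Kt) (qsstarGIter0 k V)) U₀) 0 (fderiv ℝ Xf 0 X) - Lf (fderiv ℝ Xf 0 X))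
          ≤ δ₂ * p (fderiv ℝ Xf 0 X) ∧
      lam (Ψ₂ (fderiv ℝ Xf 0 X) (fderiv ℝ Xf 0 X)) ≤ μ * p (fderiv ℝ Xf 0 X) ^ 2 ∧
      p (fderiv ℝ Xf 0 X) ≤ Kc * ‖X‖ ∧
      ∃ m : ℝ, (∀ w', Lf w' = fderiv ℝ (msChart F 2 Kt k (Bj M₁ Z k) (avgFamily (Node00.avOfRecord F 2 Kt) (qsstarGIter0 k V)) U₀) 0 (fderiv ℝ Xf 0 X) →
          m ≤ fderiv ℝ (fun Y => fderiv ℝ (fun Y : PBond (F.P Kt) 0 → lieSU (Fin 2) => wilsonAction4 (expChart (1 : GaugeField (F.P Kt) 0 SU2) Y)) Y) 0 w' w') ∧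
        γ₀ * circ X - τ * ‖X‖ ^ 2 ≤ m)
    (X : GaugeSlice S T E3) :
    γ₀ * circ X - ((32 * (((F.P Kt).d : ℝ) - 1) * δ + μ + 16 * (((F.P Kt).d : ℝ) - 1) * (ρ * δ₂) * (2 + ρ * δ₂)) * Kc ^ 2 + τ) * ‖X‖ ^ 2
      ≤ ⟪X, fderiv ℝ (rGrad S T (sliceFn S T (fun177std (Node00.bgMSCoPOfRecord F 2 ν Kt k Ω) M₁ Z k) V)) 0 X⟫_ℝ := by
  obtain ⟨hX1, hX2, hXd⟩ := triple_of_contDiffAt_two hXc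
  obtain ⟨hδ₂, hμ, hK, m, hm, hcirc⟩ := hX X
  obtain ⟨φ, hφ⟩ := exists_lieSU2Coord
  have haff := haff_msChart_of_isMinimizer_family S T hk hφ (Bj M₁ Z k) (Node00.regMSCoPOfRecord F 2 ν Kt k Ω) V U₀ hmin lam X X
  have hval := eventually_sliceFn_fun177std_bgMSCoPOfRecord_eq_wilsonAction4 ν Kt k Ω M₁ Z S T V hmin
  exact B15Prop1SliceHessianOfChartFamily.h17Shape_sliceFn_of_nearFlatCriticalExpChartFamily_sub S T (fun177std (Node00.bgMSCoPOfRecord F 2 ν Kt k Ω) M₁ Z k) V U₀ hδ0 hU hX₀ hX1 hX2 hXd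
    hΨ₂ hΨd hlam X haff p hp q Lf hρ0 hμ0 hδ₂0 hRf hρ hδ₂ hμ hm hval hK hcirc


/-- ★★★ **PROPOSITION 1 [IV] AT PRINT'S (1.74) OBJECT — ONE-SIDED (1.7) EDITION — FROM (J0′) AND THE PACKAGE (N), TWIST EDITION**: as
`…_ofMinimiserFamilyCompact_ofNearFlatLetters_oneSided` with a sixth per-instance constant `τc` — the per-`X` Federbush clause reads `γ₀·circ_i(X) − τc i·‖X‖² ≤ m` and
`Cerr i` gains `+ τc i` (the edition the Ad-twisted producers of `hm` inhabit).  Everything else VERBATIM.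
[cite: Balaban1989LargeFieldI, (1.74) p.192, Prop. 1 (1.77)–(1.78) p.194 (incl. the last clause), (1.79) p.195; Balaban1989LargeFieldII, p.357, (1.7)–(1.9) p.358, (1.12)–(1.13) p.359, (1.19) p.360;
Balaban1985Variational, (7) p.278, Thm 1 (8) p.279, (47) p.285, (81) p.290, Prop. 9 (190) p.309; Balaban1988Convergent, (2.12)–(2.14) pp.256–257] -/
theorem exists_domain_prop1Printed_lfVarOn_std_su2_box_intrinsic_analytic_atZSeqCoPRecord_ofThm1TorusClass_ofMinimiserFamilyCompact_ofNearFlatLetters_sub_oneSided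
    {F : T4Family}
    (ν : Node00.Stage7Numerics) (Kt : ℕ) (hd3 : 3 ≤ (F.P Kt).d) (h0 : 0 < (F.P Kt).d) {ι : Type} [Finite ι]
    (Z Λ : ι → Set (Site (F.P Kt) 0)) (k : ι → ℕ) (M : ι → ℝ) (hk0 : ∀ i, 0 < k i) (hk : ∀ i, k i ≤ (F.P Kt).m + (F.P Kt).K)
    (eR : ι → ℝ) (heR : ∀ i, 0 < eR i)
    (T : ∀ i, Finset (PBond (F.P Kt) (k i)))
    (lo hi : ι → Fin (F.P Kt).d → ℤ) (n : ι → ℕ) (hn : ∀ i κ, hi i κ ≤ lo i κ + n i) (hN : ∀ i, n i + 2 < (F.P Kt).sitesPerDir (k i))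
    (hbox : ∀ i, pts (k i) (Λ i) = (castSite '' Set.Icc (lo i) (hi i) : Set (Site (F.P Kt) (k i))))
    (hZ : ∀ i, (boxPlaqs (lo i - 1) (hi i + 1) : Set (Plaq (F.P Kt) (k i))) ⊆ plaqsInside (pts (k i) (Z i)))
    (hTG0 : ∀ i, T i = (box (fun κ => (hi i κ - lo i κ + 1).toNat) (lo i)).image fun x =>
      (⟨castSite (x - unitVec ⟨0, h0⟩), ⟨0, h0⟩⟩ : PBond (F.P Kt) (k i)))
    (hN5 : ∀ i κ, ((hi i κ - lo i κ + 1).toNat : ℤ) + 5 < (F.P Kt).sitesPerDir (k i))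
    (K : ι → ℕ) (hK1 : ∀ i, 1 ≤ K i) (hKn : ∀ i κ, (hi i κ - lo i κ + 1).toNat ≤ K i)
    (ext : ∀ i, GaugeField (F.P Kt) (k i) SU2 → GaugeField (F.P Kt) (k i) SU2)
    (hext : ∀ i Vk, ext i Vk = extend (pts (k i) (Λ i)) (shellGauge Vk (lo i) (hi i)) Vk)
    (hlohi : ∀ i, lo i ≤ hi i)
    {γ bx : ℝ} (hγ : 0 < γ) (hbx : 0 ≤ bx)
    (hbxM : ∀ i, 12 * ((F.P Kt).d : ℝ) * ((n i : ℝ) + 2) ^ 2 ≤ bx * (M i) ^ 2)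
    {𝓐₀ : ι → ℝ} (hM : ∀ i, 1 ≤ (M i))
    {γ₀ : ℝ} (hγ₀ : 0 ≤ γ₀)
    -- (J0′) IN THE COMPACTNESS ROUTE'S SHAPE: for every compact set of base fields inside the closed guard, ONE radius
    (hMinC : ∀ i (K : Set (GaugeField (F.P Kt) (k i) SU2)), IsCompact K →
      (∀ Vk ∈ K, ∀ p ∈ plaqsInside (pts (k i) (Z i ∩ (Λ i)ᶜ)), dist1 (GaugeField.plaqHol Vk p) ≤ eR i) →
      ∃ R : ℝ, 0 < R ∧ ∀ Vk ∈ K,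
      ∃ Ũ : VecField (F.P Kt) (k i) (EuclideanSpace ℂ (Fin 3)) × VecField (F.P Kt) (k i) (EuclideanSpace ℂ (Fin 3)) →
          PBond (F.P Kt) 0 → Matrix (Fin 2) (Fin 2) ℂ,
        (∀ b a c, DifferentiableOn ℂ (fun z => Ũ z b a c) (ball 0 R)) ∧
        (∀ z ∈ ball (0 : VecField (F.P Kt) (k i) (EuclideanSpace ℂ (Fin 3)) × VecField (F.P Kt) (k i) (EuclideanSpace ℂ (Fin 3))) R,
          ∀ b a c, ‖Ũ z b a c‖ ≤ 𝓐₀ i) ∧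
        ∀ p B' : VecField (F.P Kt) (k i) E3, ‖p‖ < R → ‖B'‖ < R → ∃ U' : GaugeField (F.P Kt) 0 SU2,
          (∀ b, Ũ (cplxVec p, cplxVec B') b = ((U' b : SU2) : Matrix (Fin 2) (Fin 2) ℂ)) ∧
            IsMinimizer (Node00.avOfRecord F 2 Kt) (Node00.regMSCoPOfRecord F 2 ν Kt (k i) (maxDomT ν.M₁ (Z i))) (Bj ν.M₁ (Z i) (k i))
              (avgFamily (Node00.avOfRecord F 2 Kt) (qsstarGIter0 (k i) (expMul su2Chart B' (ext i (expMul su2Chart p Vk))))) U')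
    -- (N) THE NEAR-FLAT LETTER PACKAGE per instance and per base field in the STRICT guard (replaces (L2) `h17`)
    {δc μc ρc δ₂c Kc τc : ι → ℝ} (hδc0 : ∀ i, 0 ≤ δc i) (hμc0 : ∀ i, 0 ≤ μc i) (hρc0 : ∀ i, 0 ≤ ρc i) (hδ₂c0 : ∀ i, 0 ≤ δ₂c i)
    (hNF : ∀ i (Vk : GaugeField (F.P Kt) (k i) SU2), PlaqSmallOn (plaqsInside (pts (k i) (Z i ∩ (Λ i)ᶜ))) (eR i) Vk →
      ∃ (U₀ : GaugeField (F.P Kt) 0 SU2) (Xf : GaugeSlice (pts (k i) (Λ i)) (T i) E3 → PBond (F.P Kt) 0 → lieSU (Fin 2)),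
        (∀ b : PBond (F.P Kt) 0, ‖((U₀ b : SU2) : Matrix (Fin 2) (Fin 2) ℂ) - 1‖ ≤ δc i) ∧ Xf 0 = 0 ∧ ContDiffAt ℝ 2 Xf 0 ∧
        (∀ᶠ Y in 𝓝 (0 : GaugeSlice (pts (k i) (Λ i)) (T i) E3),
          IsMinimizer (Node00.avOfRecord F 2 Kt) (Node00.regMSCoPOfRecord F 2 ν Kt (k i) (maxDomT ν.M₁ (Z i))) (Bj ν.M₁ (Z i) (k i))
            (avgFamily (Node00.avOfRecord F 2 Kt) (qsstarGIter0 (k i) (expMul su2Chart (ιA (pts (k i) (Λ i)) (T i) Y) (ext i Vk)))) (expChart U₀ (Xf Y))) ∧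
        ∃ (Ψ₂ : (PBond (F.P Kt) 0 → lieSU (Fin 2)) →L[ℝ] (PBond (F.P Kt) 0 → lieSU (Fin 2)) →L[ℝ] (Fin (constrCard (Bj ν.M₁ (Z i) (k i)) (k i)) → lieSU (Fin 2)))
          (lam : (Fin (constrCard (Bj ν.M₁ (Z i) (k i)) (k i)) → lieSU (Fin 2)) →L[ℝ] ℝ)
          (p : Seminorm ℝ (PBond (F.P Kt) 0 → lieSU (Fin 2))) (q : (Fin (constrCard (Bj ν.M₁ (Z i) (k i)) (k i)) → lieSU (Fin 2)) → ℝ)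
          (Lf : (PBond (F.P Kt) 0 → lieSU (Fin 2)) →L[ℝ] (Fin (constrCard (Bj ν.M₁ (Z i) (k i)) (k i)) → lieSU (Fin 2)))
          (Rf : (Fin (constrCard (Bj ν.M₁ (Z i) (k i)) (k i)) → lieSU (Fin 2)) → PBond (F.P Kt) 0 → lieSU (Fin 2)),
          HasFDerivAt (fun Y => fderiv ℝ (msChart F 2 Kt (k i) (Bj ν.M₁ (Z i) (k i)) (avgFamily (Node00.avOfRecord F 2 Kt) (qsstarGIter0 (k i) (ext i Vk))) U₀) Y) Ψ₂ 0 ∧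
          (∀ᶠ Y in 𝓝 (0 : PBond (F.P Kt) 0 → lieSU (Fin 2)),
            DifferentiableAt ℝ (msChart F 2 Kt (k i) (Bj ν.M₁ (Z i) (k i)) (avgFamily (Node00.avOfRecord F 2 Kt) (qsstarGIter0 (k i) (ext i Vk))) U₀) Y) ∧
          fderiv ℝ (fun Y : PBond (F.P Kt) 0 → lieSU (Fin 2) => wilsonAction4 (expChart U₀ Y)) 0 =
            lam.comp (fderiv ℝ (msChart F 2 Kt (k i) (Bj ν.M₁ (Z i) (k i)) (avgFamily (Node00.avOfRecord F 2 Kt) (qsstarGIter0 (k i) (ext i Vk))) U₀) 0) ∧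
          (∀ Y : PBond (F.P Kt) 0 → lieSU (Fin 2), ∑ b, ‖(Y b : Matrix (Fin 2) (Fin 2) ℂ)‖ ^ 2 ≤ p Y ^ 2) ∧
          (∀ v, Lf (Rf v) = v) ∧ (∀ v, p (Rf v) ≤ ρc i * q v) ∧
          ∀ X : GaugeSlice (pts (k i) (Λ i)) (T i) E3,
            q (fderiv ℝ (msChart F 2 Kt (k i) (Bj ν.M₁ (Z i) (k i)) (avgFamily (Node00.avOfRecord F 2 Kt) (qsstarGIter0 (k i) (ext i Vk))) U₀) 0 (fderiv ℝ Xf 0 X)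
                - Lf (fderiv ℝ Xf 0 X)) ≤ δ₂c i * p (fderiv ℝ Xf 0 X) ∧
            lam (Ψ₂ (fderiv ℝ Xf 0 X) (fderiv ℝ Xf 0 X)) ≤ μc i * p (fderiv ℝ Xf 0 X) ^ 2 ∧
            p (fderiv ℝ Xf 0 X) ≤ Kc i * ‖X‖ ∧
            ∃ m : ℝ, (∀ w', Lf w' = fderiv ℝ (msChart F 2 Kt (k i) (Bj ν.M₁ (Z i) (k i)) (avgFamily (Node00.avOfRecord F 2 Kt) (qsstarGIter0 (k i) (ext i Vk))) U₀) 0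
                  (fderiv ℝ Xf 0 X) →
                m ≤ fderiv ℝ (fun Y => fderiv ℝ (fun Y : PBond (F.P Kt) 0 → lieSU (Fin 2) => wilsonAction4 (expChart (1 : GaugeField (F.P Kt) 0 SU2) Y)) Y) 0 w' w') ∧
              γ₀ * (∑ z ∈ box (fun κ => (hi i κ - lo i κ + 1).toNat + 3) (fun κ => lo i κ - 2), ∑ μ : Fin (F.P Kt).d, ∑ a : Fin 3,
                  curl (fun b => ιA (pts (k i) (Λ i)) (T i) X (⟨castSite b.1, b.2⟩ : PBond (F.P Kt) (k i)) a) z ⟨0, h0⟩ μ ^ 2) - τc i * ‖X‖ ^ 2 ≤ m)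
    -- numerics: the assembled `Cerr i` (with the twist defect `τc i`) is small, and the positivity constant fits
    (hsm : ∀ i, (32 * (((F.P Kt).d : ℝ) - 1) * δc i + μc i + 16 * (((F.P Kt).d : ℝ) - 1) * (ρc i * δ₂c i) * (2 + ρc i * δ₂c i)) * Kc i ^ 2 + τc i
      ≤ γ₀ / (2 * (3 * (K i : ℝ) ^ 2 + 2 * (K i : ℝ) ^ 4)))
    (hγle : ∀ i, γ / (M i) ^ 5 ≤ γ₀ / (2 * (3 * (K i : ℝ) ^ 2 + 2 * (K i : ℝ) ^ 4)))
    (hfar : ∀ i (b : PBond (F.P Kt) 0), b.src ∉ maxDomT ν.M₁ (Z i) 1 →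
      (⟨blockIter (k i) b.src, b.dir⟩ : PBond (F.P Kt) (k i)) ∉ bondsOf (pts (k i) (Λ i)))
    (hZblk : ∀ i, IsBlockUnion (k i) (Z i))
    (hM2 : 2 ≤ ν.M₁) (hdiv : ∀ i, side (F.P Kt).L ν.M₁ (k i) ∣ (F.P Kt).sitesPerDir 0)
    {cE B₃ a₀ a₁' cA : ℝ} (hcE0 : 0 ≤ cE) (hcE : ∀ i, 12 * ((F.P Kt).d : ℝ) * ((n i : ℝ) + 2) ^ 2 ≤ cE) (hB₃ : 0 ≤ B₃)
    (heRa : ∀ i, (cE + 1) * eR i ≤ a₁' ∧ B₃ * ((cE + 1) * eR i) ≤ ν.εreg) (ha₀ : ν.εreg ≤ a₀)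
    (hcA : 1 / 2 * (B₃ * (cE + 1) * (F.P Kt).eta 1 ^ 2) ^ 2 * (Fintype.card (Plaq (F.P Kt) 0) : ℝ) ≤ cA)
    (h15T : ∀ (k' : ℕ), k' ≤ (F.P Kt).m + (F.P Kt).K → side (F.P Kt).L ν.M₁ k' ∣ (F.P Kt).sitesPerDir 0 →
      ∀ (s : B14.Eq218Concrete.Seq (fun n : ℕ => Node00.unionsOfCubes (F.P Kt) (side (F.P Kt).L ν.M₁ n)) k'),
      Node00.Sect2.SeqSeparated ν.M₁ s → 0 < ν.M₁ →
      ∀ (ε₀ : ℝ) (δ : ℕ → ℝ), (∀ j, j ≤ k' → 0 < δ j ∧ δ j ≤ a₁' ∧ B₃ * δ j ≤ ε₀) → (∀ j, j < k' → δ j ≤ 2 * δ (j + 1)) →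
      (∀ j, j < k' → δ (j + 1) ≤ 2 * δ j) → ε₀ ≤ a₀ →
      ∀ W : MSField (F.P Kt) SU2,
        Node00.Sect2.DataSmall7PTop (Node00.avOfRecord F 2 Kt) s.Ω (Node00.suppDomOfRecord F ν Kt s.Ω) k' δ W →
        ∀ U₀ : GaugeField (F.P Kt) 0 SU2, IsMinimizer (Node00.avOfRecord F 2 Kt)
            {U | (∀ j, j ≤ k' → PlaqSmallOn (Node00.Sect2.omegaPlaqsTop s.Ω (Node00.suppDomOfRecord F ν Kt s.Ω) j)
                (ε₀ * (F.P Kt).eta j ^ 2) U) ∧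
              Node00.Sect2.CoDivClassOnTop s.Ω (Node00.suppDomOfRecord F ν Kt s.Ω) k' ε₀ U}
            (genSet s.Ω k') W U₀ →
          (∀ j, j ≤ k' → PlaqSmallOn (Node00.Sect2.omegaPlaqsTop s.Ω (Node00.suppDomOfRecord F ν Kt s.Ω) j)
              (B₃ * δ j * (F.P Kt).eta j ^ 2) U₀) ∧
            ∀ j, j ≤ k' → Node00.Sect2.CoDivSmallOn (Node00.Sect2.omegaBondsTop s.Ω (Node00.suppDomOfRecord F ν Kt s.Ω) j)
              (B₃ * δ j * (F.P Kt).eta j ^ 3) U₀)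
    : ∃ R : ι → ℝ, (∀ i, 0 < R i) ∧ ∃ a₁ : ι → ℝ, (∀ i, 0 < a₁ i) ∧
      B15.Prop1Printed (lfVarOn su2Chart fun i =>
        InstOn.std (Node00.bgMSCoPOfRecord F 2 ν Kt (k i) (maxDomT ν.M₁ (Z i))) ν.M₁ (Z i) (Λ i) (k i) (M i) (a₁ i)
          (anExt (pts (k i) (Λ i)) (T i)
            (fun177std (Node00.bgMSCoPOfRecord F 2 ν Kt (k i) (maxDomT ν.M₁ (Z i))) ν.M₁ (Z i) (k i)) (ext i)
            (min (1 / 2) (min (R i / 8) (γ / (M i) ^ 5 * (R i / 2) ^ 2 /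
              (48 * (4 * ((Fintype.card (Plaq (F.P Kt) 0) : ℝ) * (1 + 8 * 𝓐₀ i ^ 4)) / R i + 1))))))) :=
  exists_domain_prop1Printed_lfVarOn_std_su2_box_intrinsic_analytic_atZSeqCoPRecord_ofThm1TorusClass_ofMinimiserFamilyCompact_oneSided ν Kt hd3 h0
    (hdec := inferInstance) (Subsingleton.elim _ _)
    Z Λ k M hk0 hk eR heR T lo hi n hn hN hbox hZ hTG0 hN5 K hK1 hKn ext hext hlohi hγ hbx hbxM hM hγ₀ hMinC
    (Cerr := fun i => (32 * (((F.P Kt).d : ℝ) - 1) * δc i + μc i + 16 * (((F.P Kt).d : ℝ) - 1) * (ρc i * δ₂c i) * (2 + ρc i * δ₂c i)) * Kc i ^ 2 + τc i)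
    (fun i Vk hV X => by
      obtain ⟨U₀, Xf, hU, hX₀, hXc, hmin, Ψ₂, lam, p, q, Lf, Rf, hΨ₂, hΨd, hlam, hp, hRf, hρ, hX⟩ := hNF i Vk hV
      exact h17Clause_of_nearFlatLetters_sub ν Kt (hk i) (maxDomT ν.M₁ (Z i)) ν.M₁ (Z i) (pts (k i) (Λ i)) (T i) (ext i Vk)
        (fun X => ∑ z ∈ box (fun κ => (hi i κ - lo i κ + 1).toNat + 3) (fun κ => lo i κ - 2), ∑ μ : Fin (F.P Kt).d, ∑ a : Fin 3,
          curl (fun b => ιA (pts (k i) (Λ i)) (T i) X (⟨castSite b.1, b.2⟩ : PBond (F.P Kt) (k i)) a) z ⟨0, h0⟩ μ ^ 2)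
        (hδc0 i) (hμc0 i) (hρc0 i) (hδ₂c0 i) U₀ hU Xf hX₀ hXc hmin hΨ₂ hΨd hlam p hp q Lf hRf hρ hX X)
    hsm hγle hfar hZblk hM2 hdiv hcE0 hcE hB₃ heRa ha₀ hcA h15T

end Twist

/-! ## §5  (v1.2) The twist + LOCALISED editions: near-flatness of `U₀` only where the family moves (dag-n12-w5's LOCATED-hU; road (r1) w4 g3, (r2) w5 g3) -/

section TwistLocal

variable {F : T4Family}

/-- ★★ **THE `h17` CLAUSE FROM THE PACKAGE (N) — TWIST + LOCALISED EDITION (the inhabitable one)**: as `h17Clause_of_nearFlatLetters_sub` at the endpoint's own shapes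
(slice `GaugeSlice (pts k Λ) T`, base `ext Ṽ_k`, class `regMSCoPOfRecord F 2 ν Kt k (maxDomT ν.M₁ Z)`), but the near-flatness of `U₀` is asked ONLY on the plaquettes with a bond
starting in `Ω₁(Z) = maxDomT ν.M₁ Z 1` (dag-n12-w5's LOCATED-hU: on the Γ₀-bonds the (2.12) constraint pins `U₀` to the raw datum); the direction `X_f′X` VANISHES on the other bonds by the
support letter `B15Prop1RealChartFamilySupport.support_realChartFamily_atRecord` ((K′) + the endpoint's `hfar`), and dag-n12-w4's localised skeleton
`B16Ineq17NearFlatWilsonLettersLocal.hessian_wilsonAction4_criticalExpChartFamily_ge_flatMin_sub_local` replaces the global one.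
[cite: Balaban1989LargeFieldII, p.357 («U₀ = exp iξA₀ … on the domain Z»), (1.7)–(1.9) p.358, (1.12)–(1.13) p.359, (1.19) p.360; Balaban1989LargeFieldI, (1.74) p.192, (1.77) and Prop. 1 p.194; Balaban1988Convergent, (2.2) p.255, (2.12)–(2.13) pp.256–257; Balaban1985Variational, (47) p.285, (81) p.290, Prop. 9 (190) p.309] -/
theorem h17Clause_of_nearFlatLetters_sub_loc (ν : Node00.Stage7Numerics) (Kt : ℕ) {k : ℕ} (hk0 : 0 < k) (hk : k ≤ (F.P Kt).m + (F.P Kt).K)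
    (Z Λ : Set (Site (F.P Kt) 0)) (T : Finset (PBond (F.P Kt) k))
    (ext : GaugeField (F.P Kt) k SU2 → GaugeField (F.P Kt) k SU2) (Vk : GaugeField (F.P Kt) k SU2)
    (hfar : ∀ b : PBond (F.P Kt) 0, b.src ∉ maxDomT ν.M₁ Z 1 → (⟨blockIter k b.src, b.dir⟩ : PBond (F.P Kt) k) ∉ bondsOf (pts k Λ))
    (circ : GaugeSlice (pts k Λ) T E3 → ℝ) {γ₀ δ μ ρ δ₂ Kc τ : ℝ} (hδ0 : 0 ≤ δ) (hμ0 : 0 ≤ μ) (hρ0 : 0 ≤ ρ) (hδ₂0 : 0 ≤ δ₂)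
    (U₀ : GaugeField (F.P Kt) 0 SU2)
    -- LOCALISED near-flatness: only on the plaquettes having a bond that starts in `Ω₁(Z)`
    (hU : ∀ p : Plaq (F.P Kt) 0, ((⟨p.src, p.μ⟩ : PBond (F.P Kt) 0) ∈ {b : PBond (F.P Kt) 0 | b.src ∈ maxDomT ν.M₁ Z 1} ∨
        (⟨p.src.shift p.μ, p.ν⟩ : PBond (F.P Kt) 0) ∈ {b : PBond (F.P Kt) 0 | b.src ∈ maxDomT ν.M₁ Z 1} ∨
        (⟨p.src.shift p.ν, p.μ⟩ : PBond (F.P Kt) 0) ∈ {b : PBond (F.P Kt) 0 | b.src ∈ maxDomT ν.M₁ Z 1} ∨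
        (⟨p.src, p.ν⟩ : PBond (F.P Kt) 0) ∈ {b : PBond (F.P Kt) 0 | b.src ∈ maxDomT ν.M₁ Z 1}) →
      ‖((U₀ ⟨p.src, p.μ⟩ : SU2) : Matrix (Fin 2) (Fin 2) ℂ) - 1‖ ≤ δ ∧ ‖((U₀ ⟨p.src.shift p.μ, p.ν⟩ : SU2) : Matrix (Fin 2) (Fin 2) ℂ) - 1‖ ≤ δ ∧
        ‖((U₀ ⟨p.src.shift p.ν, p.μ⟩ : SU2) : Matrix (Fin 2) (Fin 2) ℂ) - 1‖ ≤ δ ∧ ‖((U₀ ⟨p.src, p.ν⟩ : SU2) : Matrix (Fin 2) (Fin 2) ℂ) - 1‖ ≤ δ)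
    (Xf : GaugeSlice (pts k Λ) T E3 → PBond (F.P Kt) 0 → lieSU (Fin 2)) (hX₀ : Xf 0 = 0) (hXc : ContDiffAt ℝ 2 Xf 0)
    (hmin : ∀ᶠ Y in 𝓝 (0 : GaugeSlice (pts k Λ) T E3),
      IsMinimizer (Node00.avOfRecord F 2 Kt) (Node00.regMSCoPOfRecord F 2 ν Kt k (maxDomT ν.M₁ Z)) (Bj ν.M₁ Z k)
        (avgFamily (Node00.avOfRecord F 2 Kt) (qsstarGIter0 k (expMul su2Chart (ιA (pts k Λ) T Y) (ext Vk)))) (expChart U₀ (Xf Y)))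
    {Ψ₂ : (PBond (F.P Kt) 0 → lieSU (Fin 2)) →L[ℝ] (PBond (F.P Kt) 0 → lieSU (Fin 2)) →L[ℝ] (Fin (constrCard (Bj ν.M₁ Z k) k) → lieSU (Fin 2))}
    (hΨ₂ : HasFDerivAt (fun Y => fderiv ℝ (msChart F 2 Kt k (Bj ν.M₁ Z k) (avgFamily (Node00.avOfRecord F 2 Kt) (qsstarGIter0 k (ext Vk))) U₀) Y) Ψ₂ 0)
    (hΨd : ∀ᶠ Y in 𝓝 (0 : PBond (F.P Kt) 0 → lieSU (Fin 2)), DifferentiableAt ℝ (msChart F 2 Kt k (Bj ν.M₁ Z k) (avgFamily (Node00.avOfRecord F 2 Kt) (qsstarGIter0 k (ext Vk))) U₀) Y)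
    {lam : (Fin (constrCard (Bj ν.M₁ Z k) k) → lieSU (Fin 2)) →L[ℝ] ℝ}
    (hlam : fderiv ℝ (fun Y : PBond (F.P Kt) 0 → lieSU (Fin 2) => wilsonAction4 (expChart U₀ Y)) 0 =
      lam.comp (fderiv ℝ (msChart F 2 Kt k (Bj ν.M₁ Z k) (avgFamily (Node00.avOfRecord F 2 Kt) (qsstarGIter0 k (ext Vk))) U₀) 0))
    (p : Seminorm ℝ (PBond (F.P Kt) 0 → lieSU (Fin 2))) (hp : ∀ Y : PBond (F.P Kt) 0 → lieSU (Fin 2), ∑ b, ‖(Y b : Matrix (Fin 2) (Fin 2) ℂ)‖ ^ 2 ≤ p Y ^ 2)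
    (q : (Fin (constrCard (Bj ν.M₁ Z k) k) → lieSU (Fin 2)) → ℝ) (Lf : (PBond (F.P Kt) 0 → lieSU (Fin 2)) →L[ℝ] (Fin (constrCard (Bj ν.M₁ Z k) k) → lieSU (Fin 2)))
    {Rf : (Fin (constrCard (Bj ν.M₁ Z k) k) → lieSU (Fin 2)) → PBond (F.P Kt) 0 → lieSU (Fin 2)} (hRf : ∀ v, Lf (Rf v) = v) (hρ : ∀ v, p (Rf v) ≤ ρ * q v)
    -- per slice vector: (δ₂), (μ), (K) and the Federbush fibre letter with `γ₀·circ ≤ m`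
    (hX : ∀ X : GaugeSlice (pts k Λ) T E3,
      q (fderiv ℝ (msChart F 2 Kt k (Bj ν.M₁ Z k) (avgFamily (Node00.avOfRecord F 2 Kt) (qsstarGIter0 k (ext Vk))) U₀) 0 (fderiv ℝ Xf 0 X) - Lf (fderiv ℝ Xf 0 X))
          ≤ δ₂ * p (fderiv ℝ Xf 0 X) ∧
      lam (Ψ₂ (fderiv ℝ Xf 0 X) (fderiv ℝ Xf 0 X)) ≤ μ * p (fderiv ℝ Xf 0 X) ^ 2 ∧
      p (fderiv ℝ Xf 0 X) ≤ Kc * ‖X‖ ∧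
      ∃ m : ℝ, (∀ w', Lf w' = fderiv ℝ (msChart F 2 Kt k (Bj ν.M₁ Z k) (avgFamily (Node00.avOfRecord F 2 Kt) (qsstarGIter0 k (ext Vk))) U₀) 0 (fderiv ℝ Xf 0 X) →
          m ≤ fderiv ℝ (fun Y => fderiv ℝ (fun Y : PBond (F.P Kt) 0 → lieSU (Fin 2) => wilsonAction4 (expChart (1 : GaugeField (F.P Kt) 0 SU2) Y)) Y) 0 w' w') ∧
        γ₀ * circ X - τ * ‖X‖ ^ 2 ≤ m)
    (X : GaugeSlice (pts k Λ) T E3) :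
    γ₀ * circ X - ((32 * (((F.P Kt).d : ℝ) - 1) * δ + μ + 16 * (((F.P Kt).d : ℝ) - 1) * (ρ * δ₂) * (2 + ρ * δ₂)) * Kc ^ 2 + τ) * ‖X‖ ^ 2
      ≤ ⟪X, fderiv ℝ (rGrad (pts k Λ) T (sliceFn (pts k Λ) T (fun177std (Node00.bgMSCoPOfRecord F 2 ν Kt k (maxDomT ν.M₁ Z)) ν.M₁ Z k) (ext Vk))) 0 X⟫_ℝ := by
  obtain ⟨hX1, hX2, hXd⟩ := triple_of_contDiffAt_two hXc
  obtain ⟨hδ₂, hμ, hK, m, hm, hcirc⟩ := hX X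
  obtain ⟨φ, hφ⟩ := exists_lieSU2Coord
  have haff := haff_msChart_of_isMinimizer_family (pts k Λ) T hk hφ (Bj ν.M₁ Z k) (Node00.regMSCoPOfRecord F 2 ν Kt k (maxDomT ν.M₁ Z)) (ext Vk) U₀ hmin lam X X
  have hval := eventually_sliceFn_fun177std_bgMSCoPOfRecord_eq_wilsonAction4 ν Kt k (maxDomT ν.M₁ Z) ν.M₁ Z (pts k Λ) T (ext Vk) hmin
  -- the support letter (r2): the family's velocity vanishes on the bonds starting outside `Ω₁(Z)`
  have hsupp : ∀ b ∉ {b : PBond (F.P Kt) 0 | b.src ∈ maxDomT ν.M₁ Z 1}, fderiv ℝ Xf 0 X b = 0 := fun b hb =>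
    (B15Prop1RealChartFamilySupport.support_realChartFamily_atRecord ν Kt hk0 hk Z Λ T ext Vk hfar U₀ Xf hX₀ hXc.continuousAt hmin).2 X b hb
  have hd : 0 ≤ ((F.P Kt).d : ℝ) - 1 := by
    have h1 : (1 : ℝ) ≤ (F.P Kt).d := by exact_mod_cast (F.P Kt).hd
    linarith
  have hC : 0 ≤ 32 * (((F.P Kt).d : ℝ) - 1) * δ + μ + 16 * (((F.P Kt).d : ℝ) - 1) * (ρ * δ₂) * (2 + ρ * δ₂) := by positivity
  have hlow := B16Ineq17NearFlatWilsonLettersLocal.hessian_wilsonAction4_criticalExpChartFamily_ge_flatMin_sub_local (N := 2) U₀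
    {b : PBond (F.P Kt) 0 | b.src ∈ maxDomT ν.M₁ Z 1} hδ0 hU (X := Xf) (g₀ := (0 : GaugeSlice (pts k Λ) T E3))
    hX₀ hX1 hX2 hXd hΨ₂ hΨd hlam X hsupp haff p hp q Lf hρ0 hRf hρ hδ₂ hμ hm
  exact B15Prop1SliceHessianOfChartFamily.h17Shape_of_hessian_chartFamily_ge_sub (pts k Λ) T
    (fun177std (Node00.bgMSCoPOfRecord F 2 ν Kt k (maxDomT ν.M₁ Z)) ν.M₁ Z k) (ext Vk) U₀ hX1 hX2 hXd hval X p hC hlow hcirc hK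

/-- ★★★ **PROPOSITION 1 [IV] AT PRINT'S (1.74) OBJECT — ONE-SIDED (1.7) EDITION — FROM (J0′) AND THE PACKAGE (N), TWIST + LOCALISED EDITION** (the edition whose every
binder is inhabitable at the record as far as this lane knows): as `…_ofNearFlatLetters_sub_oneSided` with `hNF`'s near-flatness conjunct LOCALISED to the plaquettes having a bond
that starts in `Ω₁(Z_i) = maxDomT ν.M₁ (Z i) 1` (the Γ₀-bonds carry the raw datum and no letter is asked there); the family's velocity vanishes off those bonds by the support letter
((K′) + `hfar`, inside).  Everything else VERBATIM.
[cite: Balaban1989LargeFieldI, (1.74) p.192, Prop. 1 (1.77)–(1.78) p.194 (incl. the last clause), (1.79) p.195; Balaban1989LargeFieldII, p.357, (1.7)–(1.9) p.358, (1.12)–(1.13) p.359, (1.19) p.360;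
Balaban1985Variational, (7) p.278, Thm 1 (8) p.279, (47) p.285, (81) p.290, Prop. 9 (190) p.309; Balaban1988Convergent, (2.2) p.255, (2.12)–(2.14) pp.256–257] -/
theorem exists_domain_prop1Printed_lfVarOn_std_su2_box_intrinsic_analytic_atZSeqCoPRecord_ofThm1TorusClass_ofMinimiserFamilyCompact_ofNearFlatLetters_sub_loc_oneSided
    {F : T4Family}
    (ν : Node00.Stage7Numerics) (Kt : ℕ) (hd3 : 3 ≤ (F.P Kt).d) (h0 : 0 < (F.P Kt).d) {ι : Type} [Finite ι]
    (Z Λ : ι → Set (Site (F.P Kt) 0)) (k : ι → ℕ) (M : ι → ℝ) (hk0 : ∀ i, 0 < k i) (hk : ∀ i, k i ≤ (F.P Kt).m + (F.P Kt).K)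
    (eR : ι → ℝ) (heR : ∀ i, 0 < eR i)
    (T : ∀ i, Finset (PBond (F.P Kt) (k i)))
    (lo hi : ι → Fin (F.P Kt).d → ℤ) (n : ι → ℕ) (hn : ∀ i κ, hi i κ ≤ lo i κ + n i) (hN : ∀ i, n i + 2 < (F.P Kt).sitesPerDir (k i))
    (hbox : ∀ i, pts (k i) (Λ i) = (castSite '' Set.Icc (lo i) (hi i) : Set (Site (F.P Kt) (k i))))
    (hZ : ∀ i, (boxPlaqs (lo i - 1) (hi i + 1) : Set (Plaq (F.P Kt) (k i))) ⊆ plaqsInside (pts (k i) (Z i)))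
    (hTG0 : ∀ i, T i = (box (fun κ => (hi i κ - lo i κ + 1).toNat) (lo i)).image fun x =>
      (⟨castSite (x - unitVec ⟨0, h0⟩), ⟨0, h0⟩⟩ : PBond (F.P Kt) (k i)))
    (hN5 : ∀ i κ, ((hi i κ - lo i κ + 1).toNat : ℤ) + 5 < (F.P Kt).sitesPerDir (k i))
    (K : ι → ℕ) (hK1 : ∀ i, 1 ≤ K i) (hKn : ∀ i κ, (hi i κ - lo i κ + 1).toNat ≤ K i)
    (ext : ∀ i, GaugeField (F.P Kt) (k i) SU2 → GaugeField (F.P Kt) (k i) SU2)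
    (hext : ∀ i Vk, ext i Vk = extend (pts (k i) (Λ i)) (shellGauge Vk (lo i) (hi i)) Vk)
    (hlohi : ∀ i, lo i ≤ hi i)
    {γ bx : ℝ} (hγ : 0 < γ) (hbx : 0 ≤ bx)
    (hbxM : ∀ i, 12 * ((F.P Kt).d : ℝ) * ((n i : ℝ) + 2) ^ 2 ≤ bx * (M i) ^ 2)
    {𝓐₀ : ι → ℝ} (hM : ∀ i, 1 ≤ (M i))
    {γ₀ : ℝ} (hγ₀ : 0 ≤ γ₀)
    -- (J0′) IN THE COMPACTNESS ROUTE'S SHAPE: for every compact set of base fields inside the closed guard, ONE radius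
    (hMinC : ∀ i (K : Set (GaugeField (F.P Kt) (k i) SU2)), IsCompact K →
      (∀ Vk ∈ K, ∀ p ∈ plaqsInside (pts (k i) (Z i ∩ (Λ i)ᶜ)), dist1 (GaugeField.plaqHol Vk p) ≤ eR i) →
      ∃ R : ℝ, 0 < R ∧ ∀ Vk ∈ K,
      ∃ Ũ : VecField (F.P Kt) (k i) (EuclideanSpace ℂ (Fin 3)) × VecField (F.P Kt) (k i) (EuclideanSpace ℂ (Fin 3)) →
          PBond (F.P Kt) 0 → Matrix (Fin 2) (Fin 2) ℂ,
        (∀ b a c, DifferentiableOn ℂ (fun z => Ũ z b a c) (ball 0 R)) ∧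
        (∀ z ∈ ball (0 : VecField (F.P Kt) (k i) (EuclideanSpace ℂ (Fin 3)) × VecField (F.P Kt) (k i) (EuclideanSpace ℂ (Fin 3))) R,
          ∀ b a c, ‖Ũ z b a c‖ ≤ 𝓐₀ i) ∧
        ∀ p B' : VecField (F.P Kt) (k i) E3, ‖p‖ < R → ‖B'‖ < R → ∃ U' : GaugeField (F.P Kt) 0 SU2,
          (∀ b, Ũ (cplxVec p, cplxVec B') b = ((U' b : SU2) : Matrix (Fin 2) (Fin 2) ℂ)) ∧
            IsMinimizer (Node00.avOfRecord F 2 Kt) (Node00.regMSCoPOfRecord F 2 ν Kt (k i) (maxDomT ν.M₁ (Z i))) (Bj ν.M₁ (Z i) (k i))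
              (avgFamily (Node00.avOfRecord F 2 Kt) (qsstarGIter0 (k i) (expMul su2Chart B' (ext i (expMul su2Chart p Vk))))) U')
    -- (N) THE NEAR-FLAT LETTER PACKAGE per instance and per base field in the STRICT guard (replaces (L2) `h17`)
    {δc μc ρc δ₂c Kc τc : ι → ℝ} (hδc0 : ∀ i, 0 ≤ δc i) (hμc0 : ∀ i, 0 ≤ μc i) (hρc0 : ∀ i, 0 ≤ ρc i) (hδ₂c0 : ∀ i, 0 ≤ δ₂c i)
    (hNF : ∀ i (Vk : GaugeField (F.P Kt) (k i) SU2), PlaqSmallOn (plaqsInside (pts (k i) (Z i ∩ (Λ i)ᶜ))) (eR i) Vk →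
      ∃ (U₀ : GaugeField (F.P Kt) 0 SU2) (Xf : GaugeSlice (pts (k i) (Λ i)) (T i) E3 → PBond (F.P Kt) 0 → lieSU (Fin 2)),
        (∀ p : Plaq (F.P Kt) 0, ((⟨p.src, p.μ⟩ : PBond (F.P Kt) 0) ∈ {b : PBond (F.P Kt) 0 | b.src ∈ maxDomT ν.M₁ (Z i) 1} ∨
            (⟨p.src.shift p.μ, p.ν⟩ : PBond (F.P Kt) 0) ∈ {b : PBond (F.P Kt) 0 | b.src ∈ maxDomT ν.M₁ (Z i) 1} ∨
            (⟨p.src.shift p.ν, p.μ⟩ : PBond (F.P Kt) 0) ∈ {b : PBond (F.P Kt) 0 | b.src ∈ maxDomT ν.M₁ (Z i) 1} ∨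
            (⟨p.src, p.ν⟩ : PBond (F.P Kt) 0) ∈ {b : PBond (F.P Kt) 0 | b.src ∈ maxDomT ν.M₁ (Z i) 1}) →
          ‖((U₀ ⟨p.src, p.μ⟩ : SU2) : Matrix (Fin 2) (Fin 2) ℂ) - 1‖ ≤ δc i ∧ ‖((U₀ ⟨p.src.shift p.μ, p.ν⟩ : SU2) : Matrix (Fin 2) (Fin 2) ℂ) - 1‖ ≤ δc i ∧
            ‖((U₀ ⟨p.src.shift p.ν, p.μ⟩ : SU2) : Matrix (Fin 2) (Fin 2) ℂ) - 1‖ ≤ δc i ∧ ‖((U₀ ⟨p.src, p.ν⟩ : SU2) : Matrix (Fin 2) (Fin 2) ℂ) - 1‖ ≤ δc i) ∧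
        Xf 0 = 0 ∧ ContDiffAt ℝ 2 Xf 0 ∧
        (∀ᶠ Y in 𝓝 (0 : GaugeSlice (pts (k i) (Λ i)) (T i) E3),
          IsMinimizer (Node00.avOfRecord F 2 Kt) (Node00.regMSCoPOfRecord F 2 ν Kt (k i) (maxDomT ν.M₁ (Z i))) (Bj ν.M₁ (Z i) (k i))
            (avgFamily (Node00.avOfRecord F 2 Kt) (qsstarGIter0 (k i) (expMul su2Chart (ιA (pts (k i) (Λ i)) (T i) Y) (ext i Vk)))) (expChart U₀ (Xf Y))) ∧
        ∃ (Ψ₂ : (PBond (F.P Kt) 0 → lieSU (Fin 2)) →L[ℝ] (PBond (F.P Kt) 0 → lieSU (Fin 2)) →L[ℝ] (Fin (constrCard (Bj ν.M₁ (Z i) (k i)) (k i)) → lieSU (Fin 2)))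
          (lam : (Fin (constrCard (Bj ν.M₁ (Z i) (k i)) (k i)) → lieSU (Fin 2)) →L[ℝ] ℝ)
          (p : Seminorm ℝ (PBond (F.P Kt) 0 → lieSU (Fin 2))) (q : (Fin (constrCard (Bj ν.M₁ (Z i) (k i)) (k i)) → lieSU (Fin 2)) → ℝ)
          (Lf : (PBond (F.P Kt) 0 → lieSU (Fin 2)) →L[ℝ] (Fin (constrCard (Bj ν.M₁ (Z i) (k i)) (k i)) → lieSU (Fin 2)))
          (Rf : (Fin (constrCard (Bj ν.M₁ (Z i) (k i)) (k i)) → lieSU (Fin 2)) → PBond (F.P Kt) 0 → lieSU (Fin 2)),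
          HasFDerivAt (fun Y => fderiv ℝ (msChart F 2 Kt (k i) (Bj ν.M₁ (Z i) (k i)) (avgFamily (Node00.avOfRecord F 2 Kt) (qsstarGIter0 (k i) (ext i Vk))) U₀) Y) Ψ₂ 0 ∧
          (∀ᶠ Y in 𝓝 (0 : PBond (F.P Kt) 0 → lieSU (Fin 2)),
            DifferentiableAt ℝ (msChart F 2 Kt (k i) (Bj ν.M₁ (Z i) (k i)) (avgFamily (Node00.avOfRecord F 2 Kt) (qsstarGIter0 (k i) (ext i Vk))) U₀) Y) ∧
          fderiv ℝ (fun Y : PBond (F.P Kt) 0 → lieSU (Fin 2) => wilsonAction4 (expChart U₀ Y)) 0 =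
            lam.comp (fderiv ℝ (msChart F 2 Kt (k i) (Bj ν.M₁ (Z i) (k i)) (avgFamily (Node00.avOfRecord F 2 Kt) (qsstarGIter0 (k i) (ext i Vk))) U₀) 0) ∧
          (∀ Y : PBond (F.P Kt) 0 → lieSU (Fin 2), ∑ b, ‖(Y b : Matrix (Fin 2) (Fin 2) ℂ)‖ ^ 2 ≤ p Y ^ 2) ∧
          (∀ v, Lf (Rf v) = v) ∧ (∀ v, p (Rf v) ≤ ρc i * q v) ∧
          ∀ X : GaugeSlice (pts (k i) (Λ i)) (T i) E3,
            q (fderiv ℝ (msChart F 2 Kt (k i) (Bj ν.M₁ (Z i) (k i)) (avgFamily (Node00.avOfRecord F 2 Kt) (qsstarGIter0 (k i) (ext i Vk))) U₀) 0 (fderiv ℝ Xf 0 X)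
                - Lf (fderiv ℝ Xf 0 X)) ≤ δ₂c i * p (fderiv ℝ Xf 0 X) ∧
            lam (Ψ₂ (fderiv ℝ Xf 0 X) (fderiv ℝ Xf 0 X)) ≤ μc i * p (fderiv ℝ Xf 0 X) ^ 2 ∧
            p (fderiv ℝ Xf 0 X) ≤ Kc i * ‖X‖ ∧
            ∃ m : ℝ, (∀ w', Lf w' = fderiv ℝ (msChart F 2 Kt (k i) (Bj ν.M₁ (Z i) (k i)) (avgFamily (Node00.avOfRecord F 2 Kt) (qsstarGIter0 (k i) (ext i Vk))) U₀) 0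
                  (fderiv ℝ Xf 0 X) →
                m ≤ fderiv ℝ (fun Y => fderiv ℝ (fun Y : PBond (F.P Kt) 0 → lieSU (Fin 2) => wilsonAction4 (expChart (1 : GaugeField (F.P Kt) 0 SU2) Y)) Y) 0 w' w') ∧
              γ₀ * (∑ z ∈ box (fun κ => (hi i κ - lo i κ + 1).toNat + 3) (fun κ => lo i κ - 2), ∑ μ : Fin (F.P Kt).d, ∑ a : Fin 3,
                  curl (fun b => ιA (pts (k i) (Λ i)) (T i) X (⟨castSite b.1, b.2⟩ : PBond (F.P Kt) (k i)) a) z ⟨0, h0⟩ μ ^ 2) - τc i * ‖X‖ ^ 2 ≤ m)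
    -- numerics: the assembled `Cerr i` (with the twist defect `τc i`) is small, and the positivity constant fits
    (hsm : ∀ i, (32 * (((F.P Kt).d : ℝ) - 1) * δc i + μc i + 16 * (((F.P Kt).d : ℝ) - 1) * (ρc i * δ₂c i) * (2 + ρc i * δ₂c i)) * Kc i ^ 2 + τc i
      ≤ γ₀ / (2 * (3 * (K i : ℝ) ^ 2 + 2 * (K i : ℝ) ^ 4)))
    (hγle : ∀ i, γ / (M i) ^ 5 ≤ γ₀ / (2 * (3 * (K i : ℝ) ^ 2 + 2 * (K i : ℝ) ^ 4)))
    (hfar : ∀ i (b : PBond (F.P Kt) 0), b.src ∉ maxDomT ν.M₁ (Z i) 1 →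
      (⟨blockIter (k i) b.src, b.dir⟩ : PBond (F.P Kt) (k i)) ∉ bondsOf (pts (k i) (Λ i)))
    (hZblk : ∀ i, IsBlockUnion (k i) (Z i))
    (hM2 : 2 ≤ ν.M₁) (hdiv : ∀ i, side (F.P Kt).L ν.M₁ (k i) ∣ (F.P Kt).sitesPerDir 0)
    {cE B₃ a₀ a₁' cA : ℝ} (hcE0 : 0 ≤ cE) (hcE : ∀ i, 12 * ((F.P Kt).d : ℝ) * ((n i : ℝ) + 2) ^ 2 ≤ cE) (hB₃ : 0 ≤ B₃)
    (heRa : ∀ i, (cE + 1) * eR i ≤ a₁' ∧ B₃ * ((cE + 1) * eR i) ≤ ν.εreg) (ha₀ : ν.εreg ≤ a₀)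
    (hcA : 1 / 2 * (B₃ * (cE + 1) * (F.P Kt).eta 1 ^ 2) ^ 2 * (Fintype.card (Plaq (F.P Kt) 0) : ℝ) ≤ cA)
    (h15T : ∀ (k' : ℕ), k' ≤ (F.P Kt).m + (F.P Kt).K → side (F.P Kt).L ν.M₁ k' ∣ (F.P Kt).sitesPerDir 0 →
      ∀ (s : B14.Eq218Concrete.Seq (fun n : ℕ => Node00.unionsOfCubes (F.P Kt) (side (F.P Kt).L ν.M₁ n)) k'),
      Node00.Sect2.SeqSeparated ν.M₁ s → 0 < ν.M₁ →
      ∀ (ε₀ : ℝ) (δ : ℕ → ℝ), (∀ j, j ≤ k' → 0 < δ j ∧ δ j ≤ a₁' ∧ B₃ * δ j ≤ ε₀) → (∀ j, j < k' → δ j ≤ 2 * δ (j + 1)) →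
      (∀ j, j < k' → δ (j + 1) ≤ 2 * δ j) → ε₀ ≤ a₀ →
      ∀ W : MSField (F.P Kt) SU2,
        Node00.Sect2.DataSmall7PTop (Node00.avOfRecord F 2 Kt) s.Ω (Node00.suppDomOfRecord F ν Kt s.Ω) k' δ W →
        ∀ U₀ : GaugeField (F.P Kt) 0 SU2, IsMinimizer (Node00.avOfRecord F 2 Kt)
            {U | (∀ j, j ≤ k' → PlaqSmallOn (Node00.Sect2.omegaPlaqsTop s.Ω (Node00.suppDomOfRecord F ν Kt s.Ω) j)
                (ε₀ * (F.P Kt).eta j ^ 2) U) ∧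
              Node00.Sect2.CoDivClassOnTop s.Ω (Node00.suppDomOfRecord F ν Kt s.Ω) k' ε₀ U}
            (genSet s.Ω k') W U₀ →
          (∀ j, j ≤ k' → PlaqSmallOn (Node00.Sect2.omegaPlaqsTop s.Ω (Node00.suppDomOfRecord F ν Kt s.Ω) j)
              (B₃ * δ j * (F.P Kt).eta j ^ 2) U₀) ∧
            ∀ j, j ≤ k' → Node00.Sect2.CoDivSmallOn (Node00.Sect2.omegaBondsTop s.Ω (Node00.suppDomOfRecord F ν Kt s.Ω) j)
              (B₃ * δ j * (F.P Kt).eta j ^ 3) U₀)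
    : ∃ R : ι → ℝ, (∀ i, 0 < R i) ∧ ∃ a₁ : ι → ℝ, (∀ i, 0 < a₁ i) ∧
      B15.Prop1Printed (lfVarOn su2Chart fun i =>
        InstOn.std (Node00.bgMSCoPOfRecord F 2 ν Kt (k i) (maxDomT ν.M₁ (Z i))) ν.M₁ (Z i) (Λ i) (k i) (M i) (a₁ i)
          (anExt (pts (k i) (Λ i)) (T i)
            (fun177std (Node00.bgMSCoPOfRecord F 2 ν Kt (k i) (maxDomT ν.M₁ (Z i))) ν.M₁ (Z i) (k i)) (ext i)
            (min (1 / 2) (min (R i / 8) (γ / (M i) ^ 5 * (R i / 2) ^ 2 /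
              (48 * (4 * ((Fintype.card (Plaq (F.P Kt) 0) : ℝ) * (1 + 8 * 𝓐₀ i ^ 4)) / R i + 1))))))) :=
  exists_domain_prop1Printed_lfVarOn_std_su2_box_intrinsic_analytic_atZSeqCoPRecord_ofThm1TorusClass_ofMinimiserFamilyCompact_oneSided ν Kt hd3 h0
    (hdec := inferInstance) (Subsingleton.elim _ _)
    Z Λ k M hk0 hk eR heR T lo hi n hn hN hbox hZ hTG0 hN5 K hK1 hKn ext hext hlohi hγ hbx hbxM hM hγ₀ hMinC
    (Cerr := fun i => (32 * (((F.P Kt).d : ℝ) - 1) * δc i + μc i + 16 * (((F.P Kt).d : ℝ) - 1) * (ρc i * δ₂c i) * (2 + ρc i * δ₂c i)) * Kc i ^ 2 + τc i)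
    (fun i Vk hV X => by
      obtain ⟨U₀, Xf, hU, hX₀, hXc, hmin, Ψ₂, lam, p, q, Lf, Rf, hΨ₂, hΨd, hlam, hp, hRf, hρ, hX⟩ := hNF i Vk hV
      exact h17Clause_of_nearFlatLetters_sub_loc ν Kt (hk0 i) (hk i) (Z i) (Λ i) (T i) (ext i) Vk (hfar i)
        (fun X => ∑ z ∈ box (fun κ => (hi i κ - lo i κ + 1).toNat + 3) (fun κ => lo i κ - 2), ∑ μ : Fin (F.P Kt).d, ∑ a : Fin 3,
          curl (fun b => ιA (pts (k i) (Λ i)) (T i) X (⟨castSite b.1, b.2⟩ : PBond (F.P Kt) (k i)) a) z ⟨0, h0⟩ μ ^ 2)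
        (hδc0 i) (hμc0 i) (hρc0 i) (hδ₂c0 i) U₀ hU Xf hX₀ hXc hmin hΨ₂ hΨd hlam p hp q Lf hRf hρ hX X)
    hsm hγle hfar hZblk hM2 hdiv hcE0 hcE hB₃ heRa ha₀ hcA h15T

end TwistLocal

end Literature.MathematicalPhysics.QuantumFieldTheory.Balaban1983to89.B15Prop1EndpointNearFlatLetters

end
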